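import Summits.KontsevichZagierPeriods.KontsevichZagierPeriods.Theses.HyperbolicBloch
import Literature.NumberTheory.Transcendental.KZIdealTetrahedron
import Literature.NumberTheory.Transcendental.KZSubcalculusInvariants
import Literature.NumberTheory.Transcendental.KZLogCalculusProofs

/-!
# Disproof of `FiveTermTransfer` (stmt-KontsevichZagierPeriods-3469) — standing adversary, gen 2

**Verdict so far: the crux RESISTS (it is very probably a theorem).** This work file records, as
Lean theorems, what any proof must use and which nearby statements are false.

Findings (numbers refer to the sections below):

1. `fiveTermTransfer_iff` — the crux unfolded: `T` is forced to be `idealTetrahedron`, `B` is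
   forced to be `signedClass ρ`; only `ρ` (a choice of representations `[T(z), t⁻³]` on the
   algebraic upper half plane, junk elsewhere) is genuinely quantified, and it is inhabited
   (`isStandardOn_stdRep`, from the tree's `KZ.idealTetrahedronRep`). No vacuity. Moreover
   (`fiveTermTransfer_iff_ρ₀`, §2) the crux is EQUIVALENT to its instance for the single family
   `ρ₀` with only `x ≠ 0`, `y ≠ 0`, `y ≠ 1` (two standard families differ by relations —
   integrand additivity with a zero representation; `x = 1`, `x = y` give `0`); and
   `signedClass_conj : B z̄ = −B z`; and with the inversion move of §5 even `y ≠ 1` goes: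
   `fiveTermTransfer_iff_ρ₀'` — crux ⇔ `∀ x y ∈ ℚ̄, x ≠ 0 → y ≠ 0 → fiveTerm (signedClass ρ₀) x y
   ∈ KZ.relations`. A prover may fix `ρ = KZ.idealTetrahedronRep` and these two side conditions.
2. NO EVALUATION KILL: `KZ.relations ≤ ker eval` is proved in the tree, and the value of the
   five-term element is Neumann's five-term combination of Bloch–Wigner values
   `D(x) − D(y) + D(y/x) − D((1−x⁻¹)/(1−y⁻¹)) + D((1−x)/(1−y))`, which vanishes identically
   (numerics: residual ≤ 9·10⁻¹⁶ over 2·10⁴ random `(x, y)` in every half-plane combination,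
   including real arguments; `vol T(z) = D(z)` checked by quadrature to 1 %). So no additive
   invariant factoring through `eval` separates the element from `KZ.relations`.
3. SIGN / ORIENTATION AUDIT (the planner's "why it might fail"): with `εᵢ = cᵢ · sign Im zᵢ`
   (`c = (+,−,+,−,+)`, `z = (x, y, y/x, (1−x⁻¹)/(1−y⁻¹), (1−x)/(1−y))`, term `i` ↔ the ideal
   tetrahedron `Δᵢ` on the 4-subset of `{∞,0,1,x,y}` omitting `(y, x, 1, ∞, 0)ᵢ`), the signed
   indicator identity `Σ εᵢ 𝟙_{Δᵢ} = 0` held at 360 140 / 360 140 Monte-Carlo points of `ℍ³` over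
   3 000 generic pairs, 3 000 pairs on each 4-concyclic wall family and 50 doubly-real pairs, and in
   EVERY sample `εᵢ = σ · sign λ_{omit(i)}` for the affine (Radon) dependence `λ` of the five points
   on the sphere (bipyramid: the two terms carrying the minority sign omit the two apexes;
   4-concyclic: one `εᵢ = 0` and a 2–2 split; 5-concyclic: all zero). 51 sign patterns
   `(sign Im zᵢ)ᵢ` occur; every zero-free pattern has `Σ εᵢ = ±1`, every one-zero pattern has
   `Σ εᵢ = 0` (table at the end of this file). A chamber argument explains it: both the sign
   pattern and the combinatorial type are locally constant off the 4-concyclic walls, and on each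
   chamber the volume identity of item 2 forces the pattern (any other pattern would impose a
   second, independent linear relation among the five volumes on an open set).
4. LOAD-BEARING HYPOTHESES (§2): `x ≠ 0`, `y ≠ 0`, the `ρ`-link `hρ`, the pinning `hB` of `B`,
   and BOTH algebraicity hypotheses are necessary — each variant with that hypothesis dropped is
   refuted by evaluation (`fiveTermTransfer_false_without_x0 / _y0 / _rhoLink / _hB / _algX /
   _algY`; the algebraicity witnesses use the transcendental point `L + i`, `L = Σ 2^{-k!}`
   Liouville's constant, where `ρ` is unconstrained junk — `(L + i, 2)` resp. `(−1, L + i)`).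
5. DECORATIVE HYPOTHESES (§3, §5): the instances `x = 1` and `x = y` of the element are literally
   `0` (`fiveTerm_one_left`, `fiveTerm_self`); the instance `y = 1` is `B x + B x⁻¹ = [T x] − [T(1/x̄)]`
   (`fiveTerm_one_right`), the inversion relation, PROVED in §5 to be ONE rule-(2) move
   (`inversion_mem_changeOfVariablesRel`, inversion in the unit sphere; re-derivation of gen 1's
   evidence `Inversion.lean`) and to hold for every standard family
   (`fiveTerm_one_right_mem_relations`). So `x ≠ 1`, `x ≠ y`, `y ≠ 1` are removable.
6. REFUTED STRENGTHENINGS (§4):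
   * `not_FiveTermTransferUnsigned` — dropping the sign of the lower half plane
     (`B z = +[ρ z̄]` for `Im z < 0`) is false (witness `x = (3+4i)/5`, `y = x̄`).
   * `not_FiveTermTransferByAdditivity` — the element is NOT in the subgroup generated by the
     additivity moves (1a) + (1b) alone (witness `(i, 2i)`, separated by the tree's invariant
     `KZ.restrictedEval` (`KZSubcalculusInvariants.lean`) at a box inside `T(2i)` and outside the
     other three tetrahedra): **a change of variables (or a Newton–Leibniz move) is necessary** —
     the five standard tetrahedra are not a dissection in situ.
   * `not_FiveTermTransferByReparametrisation` — the element is NOT in the subgroup generated by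
     rules (2) + (3) alone (witness `(i, 2+i)`, separated by the augmentation `KZ.coeffSum`):
     **an additivity move is necessary**. Together: every derivation uses rule (1) and rule (2)∨(3),
     exactly the shape of the planned proof (isometries = rule (2), 2–3 move = rule (1a)).
7. Targets: none (no stuck stubs were handed over). Near-misses: none.
8. LANDED in the tree (importable, namespace `Summit.KontsevichZagierPeriods.HyperbolicBloch.
   FiveTermTransferNegative`; all accepted): `Summits/…/Theorems/FiveTermTransfer/Negative/`
   `LoadBearing.lean` (p69921: §1, §3 and the four non-algebraicity `_false_without_` theorems),
   `Algebraicity.lean` (p70348: §2 algX/algY), `Strengthenings.lean` (p70349: §4),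
   `Reduction.lean` (p70351: ρ-independence, `fiveTermTransfer_iff_ρ₀`), `Inversion.lean`
   (p70588: §5, `fiveTermTransfer_iff_ρ₀'`), `SignDictionary.lean` (p70659: §6).
9. DICTIONARY for the chamber analysis (§6): `z₄ = z₃ z₅` (`arg_four_eq_mul`) and the signs of
   `Im z₃`, `Im z₅`, `Im z₄` are the signs of the orientation of `(0,x,y)`, minus the orientation of
   `(1,x,y)`, and the concyclicity determinant of `(0,1,x,y)` (`im_arg_three/five/four`, exact
   identities with the positive factors `|x|²`, `|1−y|²`, `|x|²|1−y|²`) — the Radon minors of item 3.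

All theorems below are sorry-free; axioms ⊆ {propext, Classical.choice, Quot.sound}.
-/

noncomputable section

set_option linter.dupNamespace false

open Complex MeasureTheory Set
open scoped ComplexConjugate

namespace Summit.KontsevichZagierPeriods.KontsevichZagierPeriods.Cruxes.FiveTermTransfer.Disproof

open Literature.NumberTheory.Transcendental
open Literature.NumberTheory.Transcendental.KZ
open Literature.ModelTheory.ExponentialFields (IsSemialgebraic)
open MvPolynomial (aeval X)
open Summit.KontsevichZagierPeriods.KontsevichZagierPeriods.Theses.HyperbolicBloch (FiveTermTransfer)

/-! ## §1 Vocabulary, unfolding, non-vacuity -/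

/-- The five-term element of the crux, for a class map `B : ℂ → FormalRep`. [cite: Neumann1998, §2 eq. (2.3)] -/
def fiveTerm (B : ℂ → FormalRep) (x y : ℂ) : FormalRep :=
  B x - B y + B (y / x) - B ((1 - x⁻¹) / (1 - y⁻¹)) + B ((1 - x) / (1 - y))

/-- The signed class map forced by hypothesis `hB` of the crux: `[ρ z]` on the upper half plane,
`−[ρ z̄]` on the lower half plane, `0` on the real line. [cite: Neumann1998, §2 (orientation convention)] -/
def signedClass (ρ : ℂ → IntegralRep 3) (z : ℂ) : FormalRep :=
  if 0 < z.im then KZ.of (ρ z) else if z.im < 0 then -KZ.of (ρ (conj z)) else 0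

/-- The `ρ`-link `hρ` of the crux with `T := idealTetrahedron`: on the algebraic upper half plane
`ρ z` is a representation `[T(z), t⁻³]`. [folklore] -/
def IsStandardOn (ρ : ℂ → IntegralRep 3) : Prop :=
  ∀ z, IsAlgebraic ℚ z → 0 < z.im →
    (ρ z).domain = idealTetrahedron z ∧ EqOn (ρ z).integrand (fun p => 1 / p 2 ^ 3) (idealTetrahedron z)

/-- The standard choice of `ρ`: the tree's `KZ.idealTetrahedronRep` on the algebraic upper half
plane and an arbitrary junk family `J` elsewhere (the crux does not constrain `ρ` there). [folklore] -/
def stdRep (J : ℂ → IntegralRep 3) (z : ℂ) : IntegralRep 3 :=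
  open scoped Classical in
  if h : IsAlgebraic ℚ z ∧ 0 < z.im then idealTetrahedronRep z h.1 h.2 else J z

/-- Auxiliary: `stdRep_of_pos`. [folklore] -/
theorem stdRep_of_pos (J : ℂ → IntegralRep 3) {z : ℂ} (hz : IsAlgebraic ℚ z) (him : 0 < z.im) :
    stdRep J z = idealTetrahedronRep z hz him := by
  unfold stdRep
  rw [dif_pos ⟨hz, him⟩]

/-- Auxiliary: `stdRep_of_not`. [folklore] -/
theorem stdRep_of_not (J : ℂ → IntegralRep 3) {z : ℂ} (hz : ¬ (IsAlgebraic ℚ z ∧ 0 < z.im)) :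
    stdRep J z = J z := by
  unfold stdRep
  rw [dif_neg hz]

/-- `stdRep J` satisfies the `ρ`-link: the crux is not vacuous in `ρ`. [folklore] -/
theorem isStandardOn_stdRep (J : ℂ → IntegralRep 3) : IsStandardOn (stdRep J) := by
  intro z hz him
  rw [stdRep_of_pos J hz him]
  exact ⟨rfl, fun _ _ => rfl⟩

/-- **The crux, unfolded.** `T` and `B` are pinned by their hypotheses; the statement is a
statement about all standard choices `ρ`. [folklore] -/
theorem fiveTermTransfer_iff :
    FiveTermTransfer ↔ ∀ ρ : ℂ → IntegralRep 3, IsStandardOn ρ → ∀ x y : ℂ,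
      IsAlgebraic ℚ x → IsAlgebraic ℚ y → x ≠ 0 → x ≠ 1 → y ≠ 0 → y ≠ 1 → x ≠ y →
        fiveTerm (signedClass ρ) x y ∈ relations := by
  constructor
  · intro h ρ hρ x y hx hy hx0 hx1 hy0 hy1 hxy
    exact h idealTetrahedron (fun _ => rfl) ρ hρ (signedClass ρ) (fun _ => rfl) x y hx hy hx0 hx1
      hy0 hy1 hxy
  · intro h T hT ρ hρ B hB x y hx hy hx0 hx1 hy0 hy1 hxy
    have hT' : T = idealTetrahedron := funext fun z => hT z
    subst hT'
    have hB' : B = signedClass ρ := funext fun z => hB z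
    subst hB'
    exact h ρ hρ x y hx hy hx0 hx1 hy0 hy1 hxy

/-! ### Evaluation tools -/

/-- Soundness of the calculus (tree: `relations_le_ker_eval_holds`): relations evaluate to `0`. [cite: KontsevichZagier2001, §1.2] -/
theorem eval_eq_zero_of_mem_relations {c : FormalRep} (hc : c ∈ relations) : eval c = 0 :=
  relations_le_ker_eval_holds hc

/-- Auxiliary: `not_mem_relations_of_eval_ne_zero`. [folklore] -/
theorem not_mem_relations_of_eval_ne_zero {c : FormalRep} (h : eval c ≠ 0) : c ∉ relations :=
  fun hc => h (eval_eq_zero_of_mem_relations hc)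

/-- Auxiliary: `signedClass_of_im_pos`. [folklore] -/
theorem signedClass_of_im_pos (ρ : ℂ → IntegralRep 3) {z : ℂ} (h : 0 < z.im) :
    signedClass ρ z = KZ.of (ρ z) := by
  simp [signedClass, h]

/-- Auxiliary: `signedClass_of_im_neg`. [folklore] -/
theorem signedClass_of_im_neg (ρ : ℂ → IntegralRep 3) {z : ℂ} (h : z.im < 0) :
    signedClass ρ z = -KZ.of (ρ (conj z)) := by
  simp [signedClass, h, not_lt.mpr h.le]

/-- Auxiliary: `signedClass_of_im_zero`. [folklore] -/
theorem signedClass_of_im_zero (ρ : ℂ → IntegralRep 3) {z : ℂ} (h : z.im = 0) :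
    signedClass ρ z = 0 := by
  simp [signedClass, h]

/-! ### Algebraic points -/

/-- `i` is algebraic (`X² + 1`). [folklore] -/
theorem isAlgebraic_I : IsAlgebraic ℚ I :=
  ⟨Polynomial.X ^ 2 + 1, Polynomial.Monic.ne_zero (by monicity!), by simp⟩

/-- Gaussian rationals are algebraic. [folklore] -/
theorem isAlgebraic_of_eq_rat (a b : ℚ) {z : ℂ} (h : z = (a : ℂ) + (b : ℂ) * I) : IsAlgebraic ℚ z := by
  rw [h]
  exact (isAlgebraic_algebraMap (R := ℚ) (A := ℂ) a).add
    ((isAlgebraic_algebraMap (R := ℚ) (A := ℂ) b).mul isAlgebraic_I)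

/-- The reference representation `R₀ = [T(i), t⁻³]` (value `= D(i) =` Catalan's constant `> 0`). -/
def R₀ : IntegralRep 3 := idealTetrahedronRep I isAlgebraic_I (by simp)

/-- Auxiliary: `R₀_value_pos`. [folklore] -/
theorem R₀_value_pos : 0 < R₀.value := value_idealTetrahedronRep_pos _ _ _

/-- With the constant junk `J = R₀`, every `stdRep` value is positive. -/
theorem value_stdRep_const_pos (z : ℂ) : 0 < (stdRep (fun _ => R₀) z).value := by
  by_cases h : IsAlgebraic ℚ z ∧ 0 < z.im
  · rw [stdRep_of_pos _ h.1 h.2]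
    exact value_idealTetrahedronRep_pos _ _ _
  · rw [stdRep_of_not _ h]
    exact R₀_value_pos

/-! ## §3 Decorative hypotheses: the instances `x = 1`, `x = y`, `y = 1` -/

/-- The instance `x = 1` of the five-term element is literally `0` (`B 1 = B 0 = 0`), so the
hypothesis `x ≠ 1` is decoration. [folklore] -/
theorem fiveTerm_one_left (ρ : ℂ → IntegralRep 3) (y : ℂ) : fiveTerm (signedClass ρ) 1 y = 0 := by
  simp [fiveTerm, signedClass_of_im_zero]

/-- The instance `x = y` of the five-term element is literally `0`, so `x ≠ y` is decoration. [folklore] -/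
theorem fiveTerm_self (ρ : ℂ → IntegralRep 3) (x : ℂ) : fiveTerm (signedClass ρ) x x = 0 := by
  unfold fiveTerm
  have h1 : signedClass ρ (x / x) = 0 := by
    rcases eq_or_ne x 0 with rfl | hx
    · simp [signedClass_of_im_zero]
    · simp [div_self hx, signedClass_of_im_zero]
  have h2 : signedClass ρ ((1 - x⁻¹) / (1 - x⁻¹)) = 0 := by
    rcases eq_or_ne (1 - x⁻¹) 0 with h | h
    · simp [h, signedClass_of_im_zero]
    · simp [div_self h, signedClass_of_im_zero]
  have h3 : signedClass ρ ((1 - x) / (1 - x)) = 0 := by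
    rcases eq_or_ne (1 - x) 0 with h | h
    · simp [h, signedClass_of_im_zero]
    · simp [div_self h, signedClass_of_im_zero]
  rw [h1, h2, h3]
  abel

/-- The instance `y = 1` of the five-term element is `B x + B x⁻¹`, i.e. for `Im x > 0` the
inversion element `[ρ x] − [ρ (1/x̄)]` (`conj x⁻¹ = 1/x̄`), which is ONE change-of-variables move
(inversion in the unit sphere; gen-1 evidence `Inversion.lean`). So `y ≠ 1` is removable too. [folklore] -/
theorem fiveTerm_one_right (ρ : ℂ → IntegralRep 3) (x : ℂ) :
    fiveTerm (signedClass ρ) x 1 = signedClass ρ x + signedClass ρ x⁻¹ := by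
  simp [fiveTerm, signedClass_of_im_zero]

/-- Auxiliary: `fiveTerm_one_right_of_im_pos`. [folklore] -/
theorem fiveTerm_one_right_of_im_pos (ρ : ℂ → IntegralRep 3) {x : ℂ} (hx : 0 < x.im) :
    fiveTerm (signedClass ρ) x 1 = KZ.of (ρ x) - KZ.of (ρ (conj x⁻¹)) := by
  have hx' : (x⁻¹).im < 0 := by
    rw [Complex.inv_im]
    have h0 : 0 < Complex.normSq x := Complex.normSq_pos.mpr (by rintro rfl; simp at hx)
    exact div_neg_of_neg_of_pos (neg_neg_of_pos hx) h0
  rw [fiveTerm_one_right, signedClass_of_im_pos ρ hx, signedClass_of_im_neg ρ hx', sub_eq_add_neg]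


/-! ## §2 Load-bearing hypotheses — `_false_without_` theorems

Each `FiveTermTransferWithout<H>` below is the crux VERBATIM with the single hypothesis `<H>`
deleted; each is refuted by exhibiting data satisfying the remaining hypotheses for which the
five-term element has non-zero value (`KZ.relations ≤ ker eval`). So any proof must use `<H>`. -/

/-- The standard `ρ` with the constant positive junk `R₀` off the algebraic upper half plane. -/
abbrev ρ₀ : ℂ → IntegralRep 3 := stdRep fun _ => R₀

/-- Auxiliary: `isStandardOn_ρ₀`. [folklore] -/
theorem isStandardOn_ρ₀ : IsStandardOn ρ₀ := isStandardOn_stdRep _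

/-- Auxiliary: `value_ρ₀_pos`. [folklore] -/
theorem value_ρ₀_pos (z : ℂ) : 0 < (ρ₀ z).value := value_stdRep_const_pos z


/-! ### `ρ`-independence and reduction to ONE standard family

Positive by-products (information for the provers): the class map is odd under conjugation, any
two standard families give equivalent elements, and the crux is equivalent to its instance for the
single family `ρ₀` with the three genuinely needed side conditions `x ≠ 0`, `y ≠ 0`, `y ≠ 1`. -/

/-- `B z̄ = −B z`: the sector's relators `[w] + [w̄]` die formally under `B`. [folklore] -/
theorem signedClass_conj (ρ : ℂ → IntegralRep 3) (z : ℂ) :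
    signedClass ρ (conj z) = -signedClass ρ z := by
  rcases lt_trichotomy z.im 0 with h | h | h
  · rw [signedClass_of_im_neg ρ h, signedClass_of_im_pos ρ (z := conj z) (by simpa using h),
      neg_neg]
  · rw [signedClass_of_im_zero ρ h, signedClass_of_im_zero ρ (z := conj z) (by simpa using h),
      neg_zero]
  · rw [signedClass_of_im_pos ρ h, signedClass_of_im_neg ρ (z := conj z) (by simpa using h),
      Complex.conj_conj]

/-- Two standard families give KZ-equivalent representations at every algebraic point of the upper
half plane (integrand additivity with a zero representation: the tree's
`KZ.of_sub_of_mem_relations_of_eqOn`). So the `∀ ρ` of the crux is harmless. [folklore] -/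
theorem of_sub_of_mem_relations_of_isStandardOn {ρ ρ' : ℂ → IntegralRep 3} (hρ : IsStandardOn ρ)
    (hρ' : IsStandardOn ρ') {z : ℂ} (hz : IsAlgebraic ℚ z) (him : 0 < z.im) :
    KZ.of (ρ z) - KZ.of (ρ' z) ∈ relations := by
  obtain ⟨hd, hi⟩ := hρ z hz him
  obtain ⟨hd', hi'⟩ := hρ' z hz him
  refine of_sub_of_mem_relations_of_eqOn (hd'.trans hd.symm) ?_
  rw [hd]
  exact fun p hp => (hi hp).trans (hi' hp).symm

/-- The signed classes of two standard families differ by a relation at algebraic points. [folklore] -/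
theorem signedClass_sub_mem_relations {ρ ρ' : ℂ → IntegralRep 3} (hρ : IsStandardOn ρ)
    (hρ' : IsStandardOn ρ') {z : ℂ} (hz : IsAlgebraic ℚ z) :
    signedClass ρ z - signedClass ρ' z ∈ relations := by
  rcases lt_trichotomy z.im 0 with h | h | h
  · rw [signedClass_of_im_neg ρ h, signedClass_of_im_neg ρ' h, neg_sub_neg]
    exact of_sub_of_mem_relations_of_isStandardOn hρ' hρ
      (by simpa using hz.algHom (starRingEnd ℂ).toRatAlgHom) (by simpa using h)
  · rw [signedClass_of_im_zero ρ h, signedClass_of_im_zero ρ' h, sub_zero]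
    exact zero_mem _
  · rw [signedClass_of_im_pos ρ h, signedClass_of_im_pos ρ' h]
    exact of_sub_of_mem_relations_of_isStandardOn hρ hρ' hz h

/-- The five-term elements of two standard families differ by a relation. [folklore] -/
theorem fiveTerm_sub_fiveTerm_mem_relations {ρ ρ' : ℂ → IntegralRep 3} (hρ : IsStandardOn ρ)
    (hρ' : IsStandardOn ρ') {x y : ℂ} (hx : IsAlgebraic ℚ x) (hy : IsAlgebraic ℚ y) :
    fiveTerm (signedClass ρ) x y - fiveTerm (signedClass ρ') x y ∈ relations := by
  have h3 : IsAlgebraic ℚ (y / x) := by rw [div_eq_mul_inv]; exact hy.mul hx.inv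
  have h4 : IsAlgebraic ℚ ((1 - x⁻¹) / (1 - y⁻¹)) := by
    rw [div_eq_mul_inv]; exact (isAlgebraic_one.sub hx.inv).mul (isAlgebraic_one.sub hy.inv).inv
  have h5 : IsAlgebraic ℚ ((1 - x) / (1 - y)) := by
    rw [div_eq_mul_inv]; exact (isAlgebraic_one.sub hx).mul (isAlgebraic_one.sub hy).inv
  have e : fiveTerm (signedClass ρ) x y - fiveTerm (signedClass ρ') x y =
      (signedClass ρ x - signedClass ρ' x) - (signedClass ρ y - signedClass ρ' y)
      + (signedClass ρ (y / x) - signedClass ρ' (y / x))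
      - (signedClass ρ ((1 - x⁻¹) / (1 - y⁻¹)) - signedClass ρ' ((1 - x⁻¹) / (1 - y⁻¹)))
      + (signedClass ρ ((1 - x) / (1 - y)) - signedClass ρ' ((1 - x) / (1 - y))) := by
    unfold fiveTerm
    abel
  rw [e]
  exact add_mem (sub_mem (add_mem (sub_mem (signedClass_sub_mem_relations hρ hρ' hx)
    (signedClass_sub_mem_relations hρ hρ' hy)) (signedClass_sub_mem_relations hρ hρ' h3))
    (signedClass_sub_mem_relations hρ hρ' h4)) (signedClass_sub_mem_relations hρ hρ' h5)

/-- **Reduction to one standard family and three side conditions.** The crux is equivalent to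
its instance for the single family `ρ₀` (any other standard family differs by relations), with
`x ≠ 1` and `x ≠ y` dropped (those instances are `0`). A prover may therefore fix
`ρ = KZ.idealTetrahedronRep`. [folklore] -/
theorem fiveTermTransfer_iff_ρ₀ :
    FiveTermTransfer ↔ ∀ x y : ℂ, IsAlgebraic ℚ x → IsAlgebraic ℚ y → x ≠ 0 → y ≠ 0 → y ≠ 1 →
      fiveTerm (signedClass ρ₀) x y ∈ relations := by
  rw [fiveTermTransfer_iff]
  constructor
  · intro h x y hx hy hx0 hy0 hy1
    rcases eq_or_ne x 1 with rfl | hx1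
    · rw [fiveTerm_one_left]; exact zero_mem _
    rcases eq_or_ne x y with rfl | hxy
    · rw [fiveTerm_self]; exact zero_mem _
    exact h ρ₀ isStandardOn_ρ₀ x y hx hy hx0 hx1 hy0 hy1 hxy
  · intro h ρ hρ x y hx hy hx0 _ hy0 hy1 _
    have e : fiveTerm (signedClass ρ) x y = (fiveTerm (signedClass ρ) x y
        - fiveTerm (signedClass ρ₀) x y) + fiveTerm (signedClass ρ₀) x y := by abel
    rw [e]
    exact add_mem (fiveTerm_sub_fiveTerm_mem_relations hρ isStandardOn_ρ₀ hx hy)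
      (h x y hx hy hx0 hy0 hy1)

/-- The crux with the hypothesis `x ≠ 0` deleted. -/
def FiveTermTransferWithoutX0 : Prop :=
  ∀ (T : ℂ → Set (Fin 3 → ℝ)), (∀ z, T z = {p | 0 < p 1 ∧ z.re * p 1 < z.im * p 0 ∧ z.im * (p 0 - 1) < (z.re - 1) * p 1 ∧ 0 < p 2 ∧ 0 < z.im * (p 0 ^ 2 + p 1 ^ 2 + p 2 ^ 2 - p 0) + (z.re - Complex.normSq z) * p 1}) →
    ∀ (ρ : ℂ → IntegralRep 3), (∀ z, IsAlgebraic ℚ z → 0 < z.im → (ρ z).domain = T z ∧ Set.EqOn (ρ z).integrand (fun p => 1 / p 2 ^ 3) (T z)) →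
    ∀ (B : ℂ → FormalRep), (∀ z, B z = if 0 < z.im then KZ.of (ρ z) else if z.im < 0 then -KZ.of (ρ ((starRingEnd ℂ) z)) else 0) →
    ∀ x y : ℂ, IsAlgebraic ℚ x → IsAlgebraic ℚ y → x ≠ 1 → y ≠ 0 → y ≠ 1 → x ≠ y →
    B x - B y + B (y / x) - B ((1 - x⁻¹) / (1 - y⁻¹)) + B ((1 - x) / (1 - y)) ∈ relations

/-- **`x ≠ 0` is load-bearing.** Witness `(x, y) = (0, 1 + i)`: with Lean's `0⁻¹ = 0`, `w / 0 = 0`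
the element collapses to `[ρ i]`, of value `vol T(i) > 0`. [folklore] -/
theorem fiveTermTransfer_false_without_x0 : ¬ FiveTermTransferWithoutX0 := by
  intro h
  have hy : IsAlgebraic ℚ (1 + I) := isAlgebraic_of_eq_rat 1 1 (by push_cast; ring)
  have hmem := h idealTetrahedron (fun _ => rfl) ρ₀ isStandardOn_ρ₀ (signedClass ρ₀) (fun _ => rfl)
    0 (1 + I) isAlgebraic_zero hy zero_ne_one (by intro e; simpa using congrArg Complex.im e)
    (by intro e; simpa using congrArg Complex.im e) (by intro e; simpa using congrArg Complex.im e)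
  change fiveTerm (signedClass ρ₀) 0 (1 + I) ∈ relations at hmem
  have e4 : (1 - (0:ℂ)⁻¹) / (1 - (1 + I)⁻¹) = 1 - I := by
    apply Complex.ext <;> simp [Complex.normSq_apply] <;> norm_num
  have e5 : (1 - (0:ℂ)) / (1 - (1 + I)) = I := by
    apply Complex.ext <;> simp
  have hconj : conj (1 - I) = 1 + I := by apply Complex.ext <;> simp
  have key : fiveTerm (signedClass ρ₀) 0 (1 + I) = KZ.of (ρ₀ I) := by
    unfold fiveTerm
    rw [div_zero, e4, e5, signedClass_of_im_zero ρ₀ (z := 0) (by simp),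
      signedClass_of_im_pos ρ₀ (z := 1 + I) (by simp), signedClass_of_im_neg ρ₀ (z := 1 - I) (by simp),
      hconj, signedClass_of_im_pos ρ₀ (z := I) (by simp)]
    abel
  refine not_mem_relations_of_eval_ne_zero ?_ hmem
  rw [key, eval_of]
  exact (value_ρ₀_pos I).ne'

/-- The crux with the hypothesis `y ≠ 0` deleted. -/
def FiveTermTransferWithoutY0 : Prop :=
  ∀ (T : ℂ → Set (Fin 3 → ℝ)), (∀ z, T z = {p | 0 < p 1 ∧ z.re * p 1 < z.im * p 0 ∧ z.im * (p 0 - 1) < (z.re - 1) * p 1 ∧ 0 < p 2 ∧ 0 < z.im * (p 0 ^ 2 + p 1 ^ 2 + p 2 ^ 2 - p 0) + (z.re - Complex.normSq z) * p 1}) →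
    ∀ (ρ : ℂ → IntegralRep 3), (∀ z, IsAlgebraic ℚ z → 0 < z.im → (ρ z).domain = T z ∧ Set.EqOn (ρ z).integrand (fun p => 1 / p 2 ^ 3) (T z)) →
    ∀ (B : ℂ → FormalRep), (∀ z, B z = if 0 < z.im then KZ.of (ρ z) else if z.im < 0 then -KZ.of (ρ ((starRingEnd ℂ) z)) else 0) →
    ∀ x y : ℂ, IsAlgebraic ℚ x → IsAlgebraic ℚ y →
    x ≠ 0 → x ≠ 1 → y ≠ 1 → x ≠ y →
    B x - B y + B (y / x) - B ((1 - x⁻¹) / (1 - y⁻¹)) + B ((1 - x) / (1 - y)) ∈ relations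

/-- **`y ≠ 0` is load-bearing.** Witness `(x, y) = ((1 + 2i)/2, 0)` (chosen with `Re x = 1/2` so
that `conj (1 - x) = x`): the element collapses to `−[ρ ((3 + 4i)/5)]`, of negative value. [folklore] -/
theorem fiveTermTransfer_false_without_y0 : ¬ FiveTermTransferWithoutY0 := by
  intro h
  have hx : IsAlgebraic ℚ ((1 + 2 * I) / 2) := isAlgebraic_of_eq_rat (1 / 2) 1 (by push_cast; ring)
  have hmem := h idealTetrahedron (fun _ => rfl) ρ₀ isStandardOn_ρ₀ (signedClass ρ₀) (fun _ => rfl)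
    ((1 + 2 * I) / 2) 0 hx isAlgebraic_zero (by intro e; simpa using congrArg Complex.im e)
    (by intro e; simpa using congrArg Complex.im e) zero_ne_one
    (by intro e; simpa using congrArg Complex.im e)
  change fiveTerm (signedClass ρ₀) ((1 + 2 * I) / 2) 0 ∈ relations at hmem
  have e4 : (1 - ((1 + 2 * I) / 2)⁻¹) / (1 - (0:ℂ)⁻¹) = (3 + 4 * I) / 5 := by
    apply Complex.ext <;> simp [Complex.div_re, Complex.div_im, Complex.normSq_apply] <;> norm_num
  have e5 : (1 - (1 + 2 * I) / 2) / (1 - (0:ℂ)) = (1 - 2 * I) / 2 := by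
    rw [sub_zero, div_one]; ring
  have hconj : conj ((1 - 2 * I) / 2) = (1 + 2 * I) / 2 :=
    Complex.ext (by rw [Complex.conj_re]; norm_num) (by rw [Complex.conj_im]; norm_num)
  have key : fiveTerm (signedClass ρ₀) ((1 + 2 * I) / 2) 0 = -KZ.of (ρ₀ ((3 + 4 * I) / 5)) := by
    unfold fiveTerm
    rw [zero_div, e4, e5, signedClass_of_im_zero ρ₀ (z := 0) (by norm_num),
      signedClass_of_im_pos ρ₀ (z := (1 + 2 * I) / 2) (by norm_num),
      signedClass_of_im_pos ρ₀ (z := (3 + 4 * I) / 5) (by norm_num),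
      signedClass_of_im_neg ρ₀ (z := (1 - 2 * I) / 2) (by norm_num), hconj]
    abel
  refine not_mem_relations_of_eval_ne_zero ?_ hmem
  rw [key, map_neg, eval_of, neg_ne_zero]
  exact (value_ρ₀_pos _).ne'

/-- The constant family `ρ ≡ R₀` (violates the `ρ`-link, used when `hρ` is deleted). -/
def ρc : ℂ → IntegralRep 3 := fun _ => R₀

/-- Auxiliary: `ρc_apply`. [folklore] -/
@[simp] theorem ρc_apply (z : ℂ) : ρc z = R₀ := rfl

/-- The crux with the `ρ`-link `hρ` deleted (`ρ` arbitrary). -/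
def FiveTermTransferWithoutRhoLink : Prop :=
  ∀ (T : ℂ → Set (Fin 3 → ℝ)), (∀ z, T z = {p | 0 < p 1 ∧ z.re * p 1 < z.im * p 0 ∧ z.im * (p 0 - 1) < (z.re - 1) * p 1 ∧ 0 < p 2 ∧ 0 < z.im * (p 0 ^ 2 + p 1 ^ 2 + p 2 ^ 2 - p 0) + (z.re - Complex.normSq z) * p 1}) →
    ∀ (ρ : ℂ → IntegralRep 3), ∀ (B : ℂ → FormalRep), (∀ z, B z = if 0 < z.im then KZ.of (ρ z) else if z.im < 0 then -KZ.of (ρ ((starRingEnd ℂ) z)) else 0) →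
    ∀ x y : ℂ, IsAlgebraic ℚ x → IsAlgebraic ℚ y →
    x ≠ 0 → x ≠ 1 → y ≠ 0 → y ≠ 1 → x ≠ y →
    B x - B y + B (y / x) - B ((1 - x⁻¹) / (1 - y⁻¹)) + B ((1 - x) / (1 - y)) ∈ relations

/-- **The `ρ`-link is load-bearing.** With the constant family `ρ ≡ R₀` and the witness
`(x, y) = (i, 2 + i)` (a generic bipyramid configuration: signs `(+,+,−,+,+)`), the element is
`−[R₀]`. [folklore] -/
theorem fiveTermTransfer_false_without_rhoLink : ¬ FiveTermTransferWithoutRhoLink := by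
  intro h
  have hy : IsAlgebraic ℚ (2 + I) := isAlgebraic_of_eq_rat 2 1 (by push_cast; ring)
  have hmem := h idealTetrahedron (fun _ => rfl) ρc (signedClass ρc) (fun _ => rfl) I (2 + I)
    isAlgebraic_I hy I_ne_zero (by intro e; simpa using congrArg Complex.im e)
    (by intro e; simpa using congrArg Complex.im e) (by intro e; simpa using congrArg Complex.im e)
    (by intro e; simpa using congrArg Complex.re e)
  change fiveTerm (signedClass ρc) I (2 + I) ∈ relations at hmem
  have e3 : (2 + I) / I = 1 - 2 * I := by
    apply Complex.ext <;> simp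
  have e4 : (1 - I⁻¹) / (1 - (2 + I)⁻¹) = 2 + I := by
    apply Complex.ext <;> simp [Complex.div_re, Complex.div_im, Complex.normSq_apply] <;> norm_num
  have e5 : (1 - I) / (1 - (2 + I)) = I := by
    apply Complex.ext <;> simp [Complex.div_re, Complex.div_im, Complex.normSq_apply] <;> norm_num
  have key : fiveTerm (signedClass ρc) I (2 + I) = -KZ.of R₀ := by
    unfold fiveTerm
    rw [e3, e4, e5, signedClass_of_im_pos ρc (z := I) (by norm_num),
      signedClass_of_im_pos ρc (z := 2 + I) (by norm_num),
      signedClass_of_im_neg ρc (z := 1 - 2 * I) (by norm_num)]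
    simp only [ρc_apply]
    abel
  refine not_mem_relations_of_eval_ne_zero ?_ hmem
  rw [key, map_neg, eval_of, neg_ne_zero]
  exact R₀_value_pos.ne'

/-- The crux with the pinning `hB` of `B` deleted (`B` arbitrary). -/
def FiveTermTransferWithoutHB : Prop :=
  ∀ (T : ℂ → Set (Fin 3 → ℝ)), (∀ z, T z = {p | 0 < p 1 ∧ z.re * p 1 < z.im * p 0 ∧ z.im * (p 0 - 1) < (z.re - 1) * p 1 ∧ 0 < p 2 ∧ 0 < z.im * (p 0 ^ 2 + p 1 ^ 2 + p 2 ^ 2 - p 0) + (z.re - Complex.normSq z) * p 1}) →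
    ∀ (ρ : ℂ → IntegralRep 3), (∀ z, IsAlgebraic ℚ z → 0 < z.im → (ρ z).domain = T z ∧ Set.EqOn (ρ z).integrand (fun p => 1 / p 2 ^ 3) (T z)) →
    ∀ (B : ℂ → FormalRep), ∀ x y : ℂ, IsAlgebraic ℚ x → IsAlgebraic ℚ y →
    x ≠ 0 → x ≠ 1 → y ≠ 0 → y ≠ 1 → x ≠ y →
    B x - B y + B (y / x) - B ((1 - x⁻¹) / (1 - y⁻¹)) + B ((1 - x) / (1 - y)) ∈ relations

/-- **`hB` is load-bearing** (trivially): with `B ≡ [R₀]` the element is `[R₀]`. [folklore] -/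
theorem fiveTermTransfer_false_without_hB : ¬ FiveTermTransferWithoutHB := by
  intro h
  have hy : IsAlgebraic ℚ (2 * I) := isAlgebraic_of_eq_rat 0 2 (by push_cast; ring)
  have hmem := h idealTetrahedron (fun _ => rfl) ρ₀ isStandardOn_ρ₀ (fun _ => KZ.of R₀) I (2 * I)
    isAlgebraic_I hy I_ne_zero (by intro e; simpa using congrArg Complex.im e)
    (by intro e; simpa using congrArg Complex.im e) (by intro e; simpa using congrArg Complex.im e)
    (by intro e; simpa using congrArg Complex.im e)
  have key : KZ.of R₀ - KZ.of R₀ + KZ.of R₀ - KZ.of R₀ + KZ.of R₀ = KZ.of R₀ := by abel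
  rw [key] at hmem
  exact not_mem_relations_of_eval_ne_zero (by rw [eval_of]; exact R₀_value_pos.ne') hmem

/-! ### Algebraicity of `x` and of `y`

Off the algebraic upper half plane `ρ` is unconstrained, so a transcendental `x` (or `y`) hands the
statement junk representations. The witnesses use `L + i` with `L = Σ 2^{-k!}` Liouville's constant
(`transcendental_liouvilleNumber`), `y = 2` (resp. `x = −1`), and the junk family
`J₁ w = −R₀` if `Im w = 1`, `R₀` otherwise, arranged so that every term of the value has the same
sign whatever the (unknown) algebraicity status of the three derived arguments. -/

/-- Liouville's constant `L = Σ_{k ≥ 0} 2^{-k!}`. -/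
def L : ℝ := liouvilleNumber 2

/-- Auxiliary: `not_isAlgebraic_L`. [folklore] -/
theorem not_isAlgebraic_L : ¬ IsAlgebraic ℚ L := fun h =>
  transcendental_liouvilleNumber (m := 2) le_rfl ((IsFractionRing.isAlgebraic_iff ℤ ℚ ℝ).mpr h)

/-- Auxiliary: `L_mul_L_ne_one`. [folklore] -/
theorem L_mul_L_ne_one : L * L ≠ 1 := by
  intro h
  rcases mul_self_eq_one_iff.mp h with h1 | h1
  · exact not_isAlgebraic_L (h1 ▸ isAlgebraic_one)
  · exact not_isAlgebraic_L (h1 ▸ isAlgebraic_one.neg)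

/-- Auxiliary: `L_ne_zero`. [folklore] -/
theorem L_ne_zero : L ≠ 0 := fun h => not_isAlgebraic_L (h ▸ isAlgebraic_zero)

/-- Auxiliary: `L_ne_two`. [folklore] -/
theorem L_ne_two : L ≠ 2 := by
  intro h
  apply not_isAlgebraic_L
  rw [h]
  exact_mod_cast isAlgebraic_algebraMap (R := ℚ) (A := ℝ) (2 : ℚ)

/-- The transcendental point `L + i` of the upper half plane. -/
def xL : ℂ := (L : ℂ) + I

/-- Auxiliary: `xL_re`. [folklore] -/
@[simp] theorem xL_re : xL.re = L := by simp [xL]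
/-- Auxiliary: `xL_im`. [folklore] -/
@[simp] theorem xL_im : xL.im = 1 := by simp [xL]

/-- Auxiliary: `not_isAlgebraic_xL`. [folklore] -/
theorem not_isAlgebraic_xL : ¬ IsAlgebraic ℚ xL := fun h =>
  not_isAlgebraic_L (by simpa using (isAlgebraic_re_im h).1)

/-- Auxiliary: `xL_ne_zero`. [folklore] -/
theorem xL_ne_zero : xL ≠ 0 := by intro e; simpa using congrArg Complex.im e

/-- Auxiliary: `normSq_xL`. [folklore] -/
theorem normSq_xL : Complex.normSq xL = L * L + 1 := by simp [Complex.normSq_apply, xL]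

/-- Auxiliary: `normSq_xL_pos`. [folklore] -/
theorem normSq_xL_pos : 0 < L * L + 1 := add_pos_of_nonneg_of_pos (mul_self_nonneg L) one_pos

/-- The junk family: `−R₀` on the horizontal line `Im w = 1`, `R₀` elsewhere. -/
def J₁ (w : ℂ) : IntegralRep 3 :=
  open scoped Classical in
  if w.im = 1 then R₀.neg else R₀

/-- The `ρ` used for the algebraicity witnesses. -/
abbrev ρ₁ : ℂ → IntegralRep 3 := stdRep J₁

/-- Auxiliary: `ρ₁_eq_neg`. [folklore] -/
theorem ρ₁_eq_neg {w : ℂ} (hw : ¬ IsAlgebraic ℚ w) (h1 : w.im = 1) : ρ₁ w = R₀.neg := by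
  show stdRep J₁ w = R₀.neg
  rw [stdRep_of_not _ (fun h => hw h.1)]
  simp [J₁, h1]

/-- Auxiliary: `value_ρ₁_pos_of_im_ne_one`. [folklore] -/
theorem value_ρ₁_pos_of_im_ne_one {w : ℂ} (hw : w.im ≠ 1) : 0 < (ρ₁ w).value := by
  show 0 < (stdRep J₁ w).value
  by_cases h : IsAlgebraic ℚ w ∧ 0 < w.im
  · rw [stdRep_of_pos _ h.1 h.2]
    exact value_idealTetrahedronRep_pos _ _ _
  · rw [stdRep_of_not _ h]
    simp [J₁, hw, R₀_value_pos]

/-- The crux with the hypothesis `IsAlgebraic ℚ x` deleted. -/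
def FiveTermTransferWithoutAlgX : Prop :=
  ∀ (T : ℂ → Set (Fin 3 → ℝ)), (∀ z, T z = {p | 0 < p 1 ∧ z.re * p 1 < z.im * p 0 ∧ z.im * (p 0 - 1) < (z.re - 1) * p 1 ∧ 0 < p 2 ∧ 0 < z.im * (p 0 ^ 2 + p 1 ^ 2 + p 2 ^ 2 - p 0) + (z.re - Complex.normSq z) * p 1}) →
    ∀ (ρ : ℂ → IntegralRep 3), (∀ z, IsAlgebraic ℚ z → 0 < z.im → (ρ z).domain = T z ∧ Set.EqOn (ρ z).integrand (fun p => 1 / p 2 ^ 3) (T z)) →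
    ∀ (B : ℂ → FormalRep), (∀ z, B z = if 0 < z.im then KZ.of (ρ z) else if z.im < 0 then -KZ.of (ρ ((starRingEnd ℂ) z)) else 0) →
    ∀ x y : ℂ, IsAlgebraic ℚ y →
    x ≠ 0 → x ≠ 1 → y ≠ 0 → y ≠ 1 → x ≠ y →
    B x - B y + B (y / x) - B ((1 - x⁻¹) / (1 - y⁻¹)) + B ((1 - x) / (1 - y)) ∈ relations

/-- **Algebraicity of `x` is load-bearing.** Witness `x = L + i` (transcendental), `y = 2`,
`ρ = ρ₁`: the value of the element is `−2·vol T(i) − (two positive volumes) < 0`. [folklore] -/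
theorem fiveTermTransfer_false_without_algX : ¬ FiveTermTransferWithoutAlgX := by
  intro h
  have hmem := h idealTetrahedron (fun _ => rfl) ρ₁ (isStandardOn_stdRep J₁) (signedClass ρ₁)
    (fun _ => rfl) xL 2 (isAlgebraic_of_eq_rat 2 0 (by push_cast; ring)) xL_ne_zero
    (by intro e; simpa using congrArg Complex.im e) two_ne_zero (by norm_num)
    (by intro e; simpa using congrArg Complex.im e)
  change fiveTerm (signedClass ρ₁) xL 2 ∈ relations at hmem
  -- the five arguments
  have him3 : ((2:ℂ) / xL).im < 0 := by
    have e : ((2:ℂ) / xL).im = -(2 / (L * L + 1)) := by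
      rw [Complex.div_im, normSq_xL]; simp [xL]
    rw [e]
    exact neg_neg_of_pos (div_pos two_pos normSq_xL_pos)
  have him3' : (conj ((2:ℂ) / xL)).im ≠ 1 := by
    have e : (conj ((2:ℂ) / xL)).im = 2 / (L * L + 1) := by
      rw [Complex.conj_im, Complex.div_im, normSq_xL]; simp [xL]
    rw [e]
    intro e
    apply L_mul_L_ne_one
    field_simp at e
    linarith
  have e4 : (1 - xL⁻¹) / (1 - (2:ℂ)⁻¹) = 2 - 2 * xL⁻¹ := by
    have h2 : (1 - (2:ℂ)⁻¹) = 2⁻¹ := by norm_num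
    rw [h2, div_eq_iff (by norm_num)]
    ring
  have him4 : 0 < ((2:ℂ) - 2 * xL⁻¹).im ∧ ((2:ℂ) - 2 * xL⁻¹).im ≠ 1 := by
    have : ((2:ℂ) - 2 * xL⁻¹).im = 2 / (L * L + 1) := by
      simp [Complex.inv_im, normSq_xL]
      ring
    rw [this]
    refine ⟨div_pos two_pos normSq_xL_pos, fun e => L_mul_L_ne_one ?_⟩
    field_simp at e
    linarith
  have e5 : (1 - xL) / (1 - 2) = xL - 1 := by ring
  have halg5 : ¬ IsAlgebraic ℚ (xL - 1) := fun h5 =>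
    not_isAlgebraic_xL (by simpa using h5.add isAlgebraic_one)
  -- evaluate
  have key : eval (fiveTerm (signedClass ρ₁) xL 2) =
      -R₀.value - (ρ₁ (conj ((2:ℂ) / xL))).value - (ρ₁ ((2:ℂ) - 2 * xL⁻¹)).value + -R₀.value := by
    unfold fiveTerm
    rw [e4, e5, signedClass_of_im_pos ρ₁ (z := xL) (by simp), signedClass_of_im_zero ρ₁ (z := 2) (by simp),
      signedClass_of_im_neg ρ₁ him3, signedClass_of_im_pos ρ₁ him4.1,
      signedClass_of_im_pos ρ₁ (z := xL - 1) (by simp), ρ₁_eq_neg not_isAlgebraic_xL xL_im,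
      ρ₁_eq_neg halg5 (by simp)]
    simp only [map_add, map_sub, map_neg, eval_of, IntegralRep.value_neg, sub_zero]
    ring
  refine not_mem_relations_of_eval_ne_zero (ne_of_lt ?_) hmem
  rw [key]
  linarith [R₀_value_pos, value_ρ₁_pos_of_im_ne_one him3', value_ρ₁_pos_of_im_ne_one him4.2]


/-- Auxiliary: `xL_ne_one`. [folklore] -/
theorem xL_ne_one : xL ≠ 1 := by intro e; simpa using congrArg Complex.im e

/-- `(L − 1)² + 1 ≠ 2`, i.e. `L ∉ {0, 2}` (both rational). -/
theorem normSq_xL_sub_one_ne_two : (L - 1) * (L - 1) + 1 ≠ 2 := by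
  intro h
  have h' : L * (L - 2) = 0 := by linear_combination h
  rcases mul_eq_zero.mp h' with h0 | h2
  · exact L_ne_zero h0
  · exact L_ne_two (sub_eq_zero.mp h2)

/-- The crux with the hypothesis `IsAlgebraic ℚ y` deleted. -/
def FiveTermTransferWithoutAlgY : Prop :=
  ∀ (T : ℂ → Set (Fin 3 → ℝ)), (∀ z, T z = {p | 0 < p 1 ∧ z.re * p 1 < z.im * p 0 ∧ z.im * (p 0 - 1) < (z.re - 1) * p 1 ∧ 0 < p 2 ∧ 0 < z.im * (p 0 ^ 2 + p 1 ^ 2 + p 2 ^ 2 - p 0) + (z.re - Complex.normSq z) * p 1}) →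
    ∀ (ρ : ℂ → IntegralRep 3), (∀ z, IsAlgebraic ℚ z → 0 < z.im → (ρ z).domain = T z ∧ Set.EqOn (ρ z).integrand (fun p => 1 / p 2 ^ 3) (T z)) →
    ∀ (B : ℂ → FormalRep), (∀ z, B z = if 0 < z.im then KZ.of (ρ z) else if z.im < 0 then -KZ.of (ρ ((starRingEnd ℂ) z)) else 0) →
    ∀ x y : ℂ, IsAlgebraic ℚ x →
    x ≠ 0 → x ≠ 1 → y ≠ 0 → y ≠ 1 → x ≠ y →
    B x - B y + B (y / x) - B ((1 - x⁻¹) / (1 - y⁻¹)) + B ((1 - x) / (1 - y)) ∈ relations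

/-- **Algebraicity of `y` is load-bearing.** Witness `x = −1`, `y = L + i` (transcendental),
`ρ = ρ₁`: `B x = 0`, `−B y` and `B (y/x) = B (−y)` each contribute `+vol T(i)` (junk `−R₀` on
the line `Im w = 1`), and the two remaining terms contribute positive volumes whatever the
algebraicity status of their arguments (`Im ≠ 1` there since `L ∉ {0, 2}`): value `> 0`. [folklore] -/
theorem fiveTermTransfer_false_without_algY : ¬ FiveTermTransferWithoutAlgY := by
  intro h
  have hmem := h idealTetrahedron (fun _ => rfl) ρ₁ (isStandardOn_stdRep J₁) (signedClass ρ₁)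
    (fun _ => rfl) (-1) xL (isAlgebraic_of_eq_rat (-1) 0 (by push_cast; ring)) (by norm_num)
    (by norm_num) xL_ne_zero xL_ne_one (by intro e; simpa using congrArg Complex.im e)
  change fiveTerm (signedClass ρ₁) (-1) xL ∈ relations at hmem
  have hN : 0 < (L - 1) * (L - 1) + 1 := add_pos_of_nonneg_of_pos (mul_self_nonneg _) one_pos
  -- third argument `y / x = -y`
  have e3 : xL / (-1) = -xL := by rw [div_neg, div_one]
  have him3 : (-xL).im < 0 := by simp
  have hc3 : (conj (-xL)).im = 1 := by simp
  have halg3 : ¬ IsAlgebraic ℚ (conj (-xL)) := fun h3 => not_isAlgebraic_xL (by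
    have h3' := (h3.algHom (starRingEnd ℂ).toRatAlgHom).neg
    simpa using h3')
  -- fourth argument `2 / (1 - y⁻¹) = 2y / (y - 1)`
  have hxL1 : xL - 1 ≠ 0 := sub_ne_zero.mpr xL_ne_one
  have hinv1 : (1 : ℂ) - xL⁻¹ ≠ 0 := by
    rw [sub_ne_zero, ne_comm, ne_eq, inv_eq_one]
    exact xL_ne_one
  have e4 : (1 - (-1:ℂ)⁻¹) / (1 - xL⁻¹) = 2 * xL / (xL - 1) := by
    rw [inv_neg, inv_one, sub_neg_eq_add, one_add_one_eq_two, div_eq_div_iff hinv1 hxL1, mul_sub,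
      mul_sub, mul_one, mul_assoc (2:ℂ) xL xL⁻¹, mul_inv_cancel₀ xL_ne_zero]
    ring
  have normSq4 : Complex.normSq (xL - 1) = (L - 1) * (L - 1) + 1 := by
    simp [Complex.normSq_apply, xL]
  have him4 : (2 * xL / (xL - 1)).im = -(2 / ((L - 1) * (L - 1) + 1)) := by
    rw [Complex.div_im, normSq4]
    simp [xL]
    field_simp
    ring
  have him4' : (conj (2 * xL / (xL - 1))).im ≠ 1 := by
    rw [Complex.conj_im, him4, neg_neg]
    intro e
    apply normSq_xL_sub_one_ne_two
    field_simp at e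
    linarith
  -- fifth argument `2 / (1 - y)`
  have e5 : (1 - (-1:ℂ)) / (1 - xL) = 2 / (1 - xL) := by
    rw [sub_neg_eq_add, one_add_one_eq_two]
  have normSq5 : Complex.normSq (1 - xL) = (L - 1) * (L - 1) + 1 := by
    simp [Complex.normSq_apply, xL]
    ring
  have him5 : ((2:ℂ) / (1 - xL)).im = 2 / ((L - 1) * (L - 1) + 1) := by
    rw [Complex.div_im, normSq5]
    simp [xL, neg_div]
  have him5' : ((2:ℂ) / (1 - xL)).im ≠ 1 := by
    rw [him5]
    intro e
    apply normSq_xL_sub_one_ne_two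
    field_simp at e
    linarith
  -- evaluate
  have key : eval (fiveTerm (signedClass ρ₁) (-1) xL) =
      R₀.value + R₀.value + (ρ₁ (conj (2 * xL / (xL - 1)))).value + (ρ₁ (2 / (1 - xL))).value := by
    unfold fiveTerm
    rw [e3, e4, e5, signedClass_of_im_zero ρ₁ (z := -1) (by simp),
      signedClass_of_im_pos ρ₁ (z := xL) (by simp), signedClass_of_im_neg ρ₁ him3,
      signedClass_of_im_neg ρ₁ (z := 2 * xL / (xL - 1))
        (by rw [him4]; exact neg_neg_of_pos (div_pos two_pos hN)),
      signedClass_of_im_pos ρ₁ (z := 2 / (1 - xL)) (by rw [him5]; exact div_pos two_pos hN),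
      ρ₁_eq_neg not_isAlgebraic_xL xL_im, ρ₁_eq_neg halg3 hc3]
    simp only [map_add, map_sub, map_neg, eval_of, IntegralRep.value_neg, zero_sub]
    ring
  refine not_mem_relations_of_eval_ne_zero (ne_of_gt ?_) hmem
  rw [key]
  linarith [R₀_value_pos, value_ρ₁_pos_of_im_ne_one him4', value_ρ₁_pos_of_im_ne_one him5']

/-! ## §4 Refuted strengthenings -/

/-! ### (4a) The sign of the lower half plane cannot be dropped -/

/-- The UNSIGNED class map: `[ρ z]` above, `+[ρ z̄]` below, `0` on the real line. -/
def unsignedClass (ρ : ℂ → IntegralRep 3) (z : ℂ) : FormalRep :=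
  if 0 < z.im then KZ.of (ρ z) else if z.im < 0 then KZ.of (ρ (conj z)) else 0

/-- Auxiliary: `unsignedClass_of_im_pos`. [folklore] -/
theorem unsignedClass_of_im_pos (ρ : ℂ → IntegralRep 3) {z : ℂ} (h : 0 < z.im) :
    unsignedClass ρ z = KZ.of (ρ z) := by
  simp [unsignedClass, h]

/-- Auxiliary: `unsignedClass_of_im_neg`. [folklore] -/
theorem unsignedClass_of_im_neg (ρ : ℂ → IntegralRep 3) {z : ℂ} (h : z.im < 0) :
    unsignedClass ρ z = KZ.of (ρ (conj z)) := by
  simp [unsignedClass, h, not_lt.mpr h.le]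

/-- The crux with the sign of the lower-half-plane branch of `hB` flipped to `+`. -/
def FiveTermTransferUnsigned : Prop :=
  ∀ (T : ℂ → Set (Fin 3 → ℝ)), (∀ z, T z = {p | 0 < p 1 ∧ z.re * p 1 < z.im * p 0 ∧ z.im * (p 0 - 1) < (z.re - 1) * p 1 ∧ 0 < p 2 ∧ 0 < z.im * (p 0 ^ 2 + p 1 ^ 2 + p 2 ^ 2 - p 0) + (z.re - Complex.normSq z) * p 1}) →
    ∀ (ρ : ℂ → IntegralRep 3), (∀ z, IsAlgebraic ℚ z → 0 < z.im → (ρ z).domain = T z ∧ Set.EqOn (ρ z).integrand (fun p => 1 / p 2 ^ 3) (T z)) →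
    ∀ (B : ℂ → FormalRep), (∀ z, B z = if 0 < z.im then KZ.of (ρ z) else if z.im < 0 then KZ.of (ρ ((starRingEnd ℂ) z)) else 0) →
    ∀ x y : ℂ, IsAlgebraic ℚ x → IsAlgebraic ℚ y →
    x ≠ 0 → x ≠ 1 → y ≠ 0 → y ≠ 1 → x ≠ y →
    B x - B y + B (y / x) - B ((1 - x⁻¹) / (1 - y⁻¹)) + B ((1 - x) / (1 - y)) ∈ relations

/-- **The orientation sign is load-bearing.** Witness `x = (3 + 4i)/5`, `y = x̄` (`|x| = 1`):
`B x` and `B y` cancel, `z₄` and `z̅₅` coincide, and the unsigned element collapses to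
`[ρ ((−7 + 24i)/25)]`, of value `vol T((−7+24i)/25) > 0`. [folklore] -/
theorem not_FiveTermTransferUnsigned : ¬ FiveTermTransferUnsigned := by
  intro h
  have hx : IsAlgebraic ℚ ((3 + 4 * I) / 5) := isAlgebraic_of_eq_rat (3 / 5) (4 / 5) (by push_cast; ring)
  have hy : IsAlgebraic ℚ ((3 - 4 * I) / 5) :=
    isAlgebraic_of_eq_rat (3 / 5) (-4 / 5) (by push_cast; ring)
  have hmem := h idealTetrahedron (fun _ => rfl) ρ₀ isStandardOn_ρ₀ (unsignedClass ρ₀) (fun _ => rfl)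
    ((3 + 4 * I) / 5) ((3 - 4 * I) / 5) hx hy (by intro e; have := congrArg Complex.im e; norm_num at this)
    (by intro e; have := congrArg Complex.im e; norm_num at this)
    (by intro e; have := congrArg Complex.im e; norm_num at this)
    (by intro e; have := congrArg Complex.im e; norm_num at this)
    (by intro e; have := congrArg Complex.im e; norm_num at this)
  change fiveTerm (unsignedClass ρ₀) ((3 + 4 * I) / 5) ((3 - 4 * I) / 5) ∈ relations at hmem
  have e3 : (3 - 4 * I) / 5 / ((3 + 4 * I) / 5) = (-7 - 24 * I) / 25 := by
    apply Complex.ext <;> simp [Complex.div_re, Complex.div_im, Complex.normSq_apply] <;> norm_num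
  have e4 : (1 - ((3 + 4 * I) / 5)⁻¹) / (1 - ((3 - 4 * I) / 5)⁻¹) = (-3 + 4 * I) / 5 := by
    apply Complex.ext <;> simp [Complex.div_re, Complex.div_im, Complex.normSq_apply] <;> norm_num
  have e5 : (1 - (3 + 4 * I) / 5) / (1 - (3 - 4 * I) / 5) = (-3 - 4 * I) / 5 := by
    apply Complex.ext <;> simp [Complex.div_re, Complex.div_im, Complex.normSq_apply] <;> norm_num
  have c2 : conj ((3 - 4 * I) / 5) = (3 + 4 * I) / 5 :=
    Complex.ext (by rw [Complex.conj_re]; norm_num) (by rw [Complex.conj_im]; norm_num)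
  have c3 : conj ((-7 - 24 * I) / 25) = (-7 + 24 * I) / 25 :=
    Complex.ext (by rw [Complex.conj_re]; norm_num) (by rw [Complex.conj_im]; norm_num)
  have c5 : conj ((-3 - 4 * I) / 5) = (-3 + 4 * I) / 5 :=
    Complex.ext (by rw [Complex.conj_re]; norm_num) (by rw [Complex.conj_im]; norm_num)
  have key : fiveTerm (unsignedClass ρ₀) ((3 + 4 * I) / 5) ((3 - 4 * I) / 5) =
      KZ.of (ρ₀ ((-7 + 24 * I) / 25)) := by
    unfold fiveTerm
    rw [e3, e4, e5, unsignedClass_of_im_pos ρ₀ (z := (3 + 4 * I) / 5) (by norm_num),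
      unsignedClass_of_im_neg ρ₀ (z := (3 - 4 * I) / 5) (by norm_num), c2,
      unsignedClass_of_im_neg ρ₀ (z := (-7 - 24 * I) / 25) (by norm_num), c3,
      unsignedClass_of_im_pos ρ₀ (z := (-3 + 4 * I) / 5) (by norm_num),
      unsignedClass_of_im_neg ρ₀ (z := (-3 - 4 * I) / 5) (by norm_num), c5]
    abel
  refine not_mem_relations_of_eval_ne_zero ?_ hmem
  rw [key, eval_of]
  exact (value_ρ₀_pos _).ne'

/-! ### (4b) The additivity moves (1a) + (1b) alone do not suffice

Invariant: evaluation LOCALISED to a window, `[r] ↦ ∫_{r.domain ∩ U} r.integrand` (the tree's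
`KZ.restrictedEval`, `KZSubcalculusInvariants.lean`), is additive over the two additivity moves (but
of course not over changes of variables). At the calibration
instance `(x, y) = (i, 2i)` the element is `[T i] − [T 2i] − [T((6+2i)/5)] + [T((3+i)/5)]`
(four standard tetrahedra in situ); the window `(0, 1/5) × (1, 3/2) × (3, ∞)` lies inside `T(2i)`
and misses the other three (`Im w ≤ 1 ⇒ T(w) ⊆ {p 1 < 1}`), so the localised value is
`−∫_window t⁻³ < 0`. -/

/-- One-variable factors of the window `(0, 1/5) × (1, 3/2) × (3, ∞)`. -/
def wInt : ℕ → Set ℝ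
  | 0 => Ioo 0 (1 / 5)
  | 1 => Ioo 1 (3 / 2)
  | 2 => Ioi 3
  | _ => univ

/-- Auxiliary: `measurableSet_wInt`. [folklore] -/
theorem measurableSet_wInt : ∀ k, MeasurableSet (wInt k)
  | 0 => measurableSet_Ioo
  | 1 => measurableSet_Ioo
  | 2 => measurableSet_Ioi
  | _ + 3 => MeasurableSet.univ

/-- Auxiliary: `isOpen_wInt`. [folklore] -/
theorem isOpen_wInt : ∀ k, IsOpen (wInt k)
  | 0 => isOpen_Ioo
  | 1 => isOpen_Ioo
  | 2 => isOpen_Ioi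
  | _ + 3 => isOpen_univ

/-- The window family (in dimension `3`: the box `(0, 1/5) × (1, 3/2) × (3, ∞)`). -/
def W (n : ℕ) : Set (Fin n → ℝ) := Set.pi univ fun i => wInt i.val

/-- Auxiliary: `measurableSet_W`. [folklore] -/
theorem measurableSet_W (n : ℕ) : MeasurableSet (W n) :=
  MeasurableSet.univ_pi fun i => measurableSet_wInt i.val

/-- Auxiliary: `isOpen_W_three`. [folklore] -/
theorem isOpen_W_three : IsOpen (W 3) :=
  isOpen_set_pi finite_univ fun i _ => isOpen_wInt i.val

/-- Auxiliary: `mem_W_three`. [folklore] -/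
theorem mem_W_three {p : Fin 3 → ℝ} :
    p ∈ W 3 ↔ (0 < p 0 ∧ p 0 < 1 / 5) ∧ (1 < p 1 ∧ p 1 < 3 / 2) ∧ 3 < p 2 := by
  simp [W, wInt, Fin.forall_fin_succ]

/-- The window lies inside `T(2i)`. -/
theorem W_three_subset : W 3 ⊆ idealTetrahedron (2 * I) := by
  intro p hp
  obtain ⟨⟨h0, h0'⟩, ⟨h1, h1'⟩, h2⟩ := mem_W_three.mp hp
  rw [mem_idealTetrahedron_iff]
  norm_num
  refine ⟨by linarith, h0, by linarith, by linarith, by nlinarith⟩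

/-- A tetrahedron `T(w)` with `Im w ≤ 1` misses the window: inside the triangle `(0, 1, w)` one has
`p 1 < Im w` (sum of the two slanted edge inequalities). -/
theorem idealTetrahedron_inter_W_three {w : ℂ} (hw : w.im ≤ 1) : idealTetrahedron w ∩ W 3 = ∅ := by
  ext p
  simp only [mem_inter_iff, mem_empty_iff_false, iff_false, not_and]
  intro hT hW
  obtain ⟨-, ⟨h1, -⟩, -⟩ := mem_W_three.mp hW
  have e1 := hT.2.1
  have e2 := hT.2.2.1
  nlinarith

/-- The crux with `KZ.relations` replaced by the subgroup generated by the additivity moves alone. -/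
def FiveTermTransferByAdditivity : Prop :=
  ∀ (T : ℂ → Set (Fin 3 → ℝ)), (∀ z, T z = {p | 0 < p 1 ∧ z.re * p 1 < z.im * p 0 ∧ z.im * (p 0 - 1) < (z.re - 1) * p 1 ∧ 0 < p 2 ∧ 0 < z.im * (p 0 ^ 2 + p 1 ^ 2 + p 2 ^ 2 - p 0) + (z.re - Complex.normSq z) * p 1}) →
    ∀ (ρ : ℂ → IntegralRep 3), (∀ z, IsAlgebraic ℚ z → 0 < z.im → (ρ z).domain = T z ∧ Set.EqOn (ρ z).integrand (fun p => 1 / p 2 ^ 3) (T z)) →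
    ∀ (B : ℂ → FormalRep), (∀ z, B z = if 0 < z.im then KZ.of (ρ z) else if z.im < 0 then -KZ.of (ρ ((starRingEnd ℂ) z)) else 0) →
    ∀ x y : ℂ, IsAlgebraic ℚ x → IsAlgebraic ℚ y →
    x ≠ 0 → x ≠ 1 → y ≠ 0 → y ≠ 1 → x ≠ y →
    B x - B y + B (y / x) - B ((1 - x⁻¹) / (1 - y⁻¹)) + B ((1 - x) / (1 - y)) ∈ AddSubgroup.closure (Literature.NumberTheory.Transcendental.KZ.domainAddRel ∪ Literature.NumberTheory.Transcendental.KZ.integrandAddRel)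

/-- **Rule (2) or rule (3) is necessary**: the five-term element is not in the subgroup generated
by the additivity moves (1a), (1b). Witness `(x, y) = (i, 2i)`, invariant `KZ.restrictedEval W`. [folklore] -/
theorem not_FiveTermTransferByAdditivity : ¬ FiveTermTransferByAdditivity := by
  intro h
  have hy : IsAlgebraic ℚ (2 * I) := isAlgebraic_of_eq_rat 0 2 (by push_cast; ring)
  have h35 : IsAlgebraic ℚ ((3 + I) / 5) := isAlgebraic_of_eq_rat (3 / 5) (1 / 5) (by push_cast; ring)
  have h62 : IsAlgebraic ℚ ((6 + 2 * I) / 5) :=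
    isAlgebraic_of_eq_rat (6 / 5) (2 / 5) (by push_cast; ring)
  have hmem := h idealTetrahedron (fun _ => rfl) ρ₀ isStandardOn_ρ₀ (signedClass ρ₀) (fun _ => rfl)
    I (2 * I) isAlgebraic_I hy I_ne_zero (by intro e; simpa using congrArg Complex.im e)
    (by intro e; have := congrArg Complex.im e; norm_num at this)
    (by intro e; have := congrArg Complex.im e; norm_num at this)
    (by intro e; have := congrArg Complex.im e; norm_num at this)
  change fiveTerm (signedClass ρ₀) I (2 * I) ∈ _ at hmem
  have e3 : 2 * I / I = 2 := by simp
  have e4 : (1 - I⁻¹) / (1 - (2 * I)⁻¹) = (6 + 2 * I) / 5 := by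
    apply Complex.ext <;> simp [Complex.div_re, Complex.div_im, Complex.normSq_apply] <;> norm_num
  have e5 : (1 - I) / (1 - 2 * I) = (3 + I) / 5 := by
    apply Complex.ext <;> simp [Complex.div_re, Complex.div_im, Complex.normSq_apply] <;> norm_num
  have key : fiveTerm (signedClass ρ₀) I (2 * I) = KZ.of (ρ₀ I) - KZ.of (ρ₀ (2 * I))
      - KZ.of (ρ₀ ((6 + 2 * I) / 5)) + KZ.of (ρ₀ ((3 + I) / 5)) := by
    unfold fiveTerm
    rw [e3, e4, e5, signedClass_of_im_pos ρ₀ (z := I) (by norm_num),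
      signedClass_of_im_pos ρ₀ (z := 2 * I) (by norm_num), signedClass_of_im_zero ρ₀ (z := 2) (by norm_num),
      signedClass_of_im_pos ρ₀ (z := (6 + 2 * I) / 5) (by norm_num),
      signedClass_of_im_pos ρ₀ (z := (3 + I) / 5) (by norm_num)]
    abel
  have hzero : restrictedEval W (fiveTerm (signedClass ρ₀) I (2 * I)) = 0 :=
    closure_add_le_ker_restrictedEval W measurableSet_W hmem
  rw [key] at hzero
  simp only [map_add, map_sub, restrictedEval_of] at hzero
  rw [show ρ₀ I = idealTetrahedronRep I isAlgebraic_I (by norm_num) from stdRep_of_pos _ _ _,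
    show ρ₀ (2 * I) = idealTetrahedronRep (2 * I) hy (by norm_num) from stdRep_of_pos _ _ _,
    show ρ₀ ((6 + 2 * I) / 5) = idealTetrahedronRep _ h62 (by norm_num) from stdRep_of_pos _ _ _,
    show ρ₀ ((3 + I) / 5) = idealTetrahedronRep _ h35 (by norm_num) from stdRep_of_pos _ _ _] at hzero
  simp only [domain_idealTetrahedronRep, integrand_idealTetrahedronRep] at hzero
  rw [idealTetrahedron_inter_W_three (w := I) (by norm_num),
    idealTetrahedron_inter_W_three (w := (6 + 2 * I) / 5) (by norm_num),
    idealTetrahedron_inter_W_three (w := (3 + I) / 5) (by norm_num),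
    inter_eq_right.mpr W_three_subset] at hzero
  simp only [Measure.restrict_empty, integral_zero_measure, zero_sub, sub_zero, add_zero] at hzero
  -- hzero : -∫ p in W 3, 1 / p 2 ^ 3 = 0
  have hpos : 0 < ∫ p in W 3, (1 : ℝ) / p 2 ^ 3 := by
    rw [setIntegral_pos_iff_support_of_nonneg_ae]
    · have hsub : W 3 ⊆ Function.support (fun p : Fin 3 → ℝ => 1 / p 2 ^ 3) ∩ W 3 := fun p hp =>
        ⟨by
          rw [Function.mem_support]
          exact one_div_ne_zero (pow_ne_zero 3 (by linarith [(mem_W_three.mp hp).2.2])), hp⟩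
      refine lt_of_lt_of_le (isOpen_W_three.measure_pos volume ⟨![1 / 10, 5 / 4, 4], ?_⟩)
        (measure_mono hsub)
      rw [mem_W_three]
      simp only [Matrix.cons_val_zero, Matrix.cons_val_one, Matrix.cons_val]
      norm_num
    · rw [Filter.EventuallyLE, ae_restrict_iff' (measurableSet_W 3)]
      exact Filter.Eventually.of_forall fun p hp => by
        have := (mem_W_three.mp hp).2.2
        positivity
    · exact (integrableOn_one_div_cube_idealTetrahedron (z := 2 * I) (by norm_num)).mono_set
        W_three_subset
  linarith

/-! ### (4c) Rules (2) + (3) alone do not suffice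

Invariant: the augmentation `[r] ↦ 1` (the tree's `KZ.coeffSum`), which kills `[r] − [r']` (every
change-of-variables and Newton–Leibniz generator) but takes the value `Σ εᵢ = ±1` on the element of
a bipyramid configuration. -/

/-- The crux with `KZ.relations` replaced by the subgroup generated by rules (2) and (3) alone. -/
def FiveTermTransferByReparametrisation : Prop :=
  ∀ (T : ℂ → Set (Fin 3 → ℝ)), (∀ z, T z = {p | 0 < p 1 ∧ z.re * p 1 < z.im * p 0 ∧ z.im * (p 0 - 1) < (z.re - 1) * p 1 ∧ 0 < p 2 ∧ 0 < z.im * (p 0 ^ 2 + p 1 ^ 2 + p 2 ^ 2 - p 0) + (z.re - Complex.normSq z) * p 1}) →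
    ∀ (ρ : ℂ → IntegralRep 3), (∀ z, IsAlgebraic ℚ z → 0 < z.im → (ρ z).domain = T z ∧ Set.EqOn (ρ z).integrand (fun p => 1 / p 2 ^ 3) (T z)) →
    ∀ (B : ℂ → FormalRep), (∀ z, B z = if 0 < z.im then KZ.of (ρ z) else if z.im < 0 then -KZ.of (ρ ((starRingEnd ℂ) z)) else 0) →
    ∀ x y : ℂ, IsAlgebraic ℚ x → IsAlgebraic ℚ y →
    x ≠ 0 → x ≠ 1 → y ≠ 0 → y ≠ 1 → x ≠ y →
    B x - B y + B (y / x) - B ((1 - x⁻¹) / (1 - y⁻¹)) + B ((1 - x) / (1 - y)) ∈ AddSubgroup.closure (Literature.NumberTheory.Transcendental.KZ.changeOfVariablesRel ∪ Literature.NumberTheory.Transcendental.KZ.newtonLeibnizRel)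

/-- **Rule (1) is necessary**: the five-term element is not in the subgroup generated by the
change-of-variables and Newton–Leibniz moves. Witness `(x, y) = (i, 2 + i)` (bipyramid
configuration, `Σ εᵢ = −1`), invariant `KZ.coeffSum`. [folklore] -/
theorem not_FiveTermTransferByReparametrisation : ¬ FiveTermTransferByReparametrisation := by
  intro h
  have hy : IsAlgebraic ℚ (2 + I) := isAlgebraic_of_eq_rat 2 1 (by push_cast; ring)
  have hmem := h idealTetrahedron (fun _ => rfl) ρ₀ isStandardOn_ρ₀ (signedClass ρ₀) (fun _ => rfl)
    I (2 + I) isAlgebraic_I hy I_ne_zero (by intro e; simpa using congrArg Complex.im e)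
    (by intro e; simpa using congrArg Complex.im e) (by intro e; simpa using congrArg Complex.im e)
    (by intro e; simpa using congrArg Complex.re e)
  change fiveTerm (signedClass ρ₀) I (2 + I) ∈ _ at hmem
  have e3 : (2 + I) / I = 1 - 2 * I := by
    apply Complex.ext <;> simp
  have e4 : (1 - I⁻¹) / (1 - (2 + I)⁻¹) = 2 + I := by
    apply Complex.ext <;> simp [Complex.div_re, Complex.div_im, Complex.normSq_apply] <;> norm_num
  have e5 : (1 - I) / (1 - (2 + I)) = I := by
    apply Complex.ext <;> simp [Complex.div_re, Complex.div_im, Complex.normSq_apply] <;> norm_num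
  have key : coeffSum (fiveTerm (signedClass ρ₀) I (2 + I)) = -1 := by
    unfold fiveTerm
    rw [e3, e4, e5, signedClass_of_im_pos ρ₀ (z := I) (by norm_num),
      signedClass_of_im_pos ρ₀ (z := 2 + I) (by norm_num),
      signedClass_of_im_neg ρ₀ (z := 1 - 2 * I) (by norm_num)]
    simp only [map_add, map_sub, map_neg, coeffSum_of]
    norm_num
  have h0 : coeffSum (fiveTerm (signedClass ρ₀) I (2 + I)) = 0 := closure_cov_nl_le_ker_coeffSum hmem
  rw [key] at h0
  norm_num at h0


/-! ## §5 The inversion move (positive by-product) and the final reduction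

`[T(x), t⁻³] − [T(1/x̄), t⁻³]` is ONE change-of-variables generator: inversion in the unit sphere
`p ↦ p/|p|²` (a `ℚ`-rational map, `|det| = |p|⁻⁶`, `t⁻³ = (t/|p|²)⁻³·|p|⁻⁶`, and `T(x) ↦ T(1/x̄)`
with the roles of the edge `1x` and the hemisphere exchanged). Consequences: the instance `y = 1`
of the crux holds for every standard family (`fiveTerm_one_right_mem_relations`), so `y ≠ 1` is
removable too, and the crux is equivalent to its `ρ₀`-instance with ONLY `x ≠ 0`, `y ≠ 0`
(`fiveTermTransfer_iff_ρ₀'`). This section is also a complete worked instance of route item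
IsometryMove (stmt-3471) inside the calculus (semialgebraicity, derivative, determinant via
`Matrix.det_fin_three`, injectivity, image). -/

/-- Squared Euclidean norm on `ℝ³`. -/
def sqn (p : Fin 3 → ℝ) : ℝ := p 0 ^ 2 + p 1 ^ 2 + p 2 ^ 2

theorem sqn_pos {p : Fin 3 → ℝ} (hp : 0 < p 2) : 0 < sqn p := by
  unfold sqn; nlinarith [sq_nonneg (p 0), sq_nonneg (p 1), mul_pos hp hp]

/-- Inversion in the unit sphere of `ℝ³`. -/
def inv3 (p : Fin 3 → ℝ) : Fin 3 → ℝ := (sqn p)⁻¹ • p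

theorem inv3_apply (p : Fin 3 → ℝ) (i : Fin 3) : inv3 p i = p i / sqn p := by
  simp [inv3, div_eq_inv_mul]

theorem sqn_inv3 {p : Fin 3 → ℝ} (h : sqn p ≠ 0) : sqn (inv3 p) = (sqn p)⁻¹ := by
  have e : sqn (inv3 p) = sqn p / (sqn p) ^ 2 := by
    simp only [sqn, inv3_apply]
    field_simp
  rw [e, pow_two, div_mul_eq_div_div, div_self h, one_div]

theorem inv3_inv3 {p : Fin 3 → ℝ} (h : sqn p ≠ 0) : inv3 (inv3 p) = p := by
  ext i
  rw [inv3_apply, sqn_inv3 h, inv3_apply]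
  field_simp

theorem injOn_inv3 {σ : Set (Fin 3 → ℝ)} (hσ : ∀ p ∈ σ, sqn p ≠ 0) : InjOn inv3 σ :=
  fun p hp q hq e => by rw [← inv3_inv3 (hσ p hp), e, inv3_inv3 (hσ q hq)]

/-- The derivative of `sqn`. -/
def sqn' (p : Fin 3 → ℝ) : (Fin 3 → ℝ) →L[ℝ] ℝ :=
  ((2 : ℕ) • p 0 ^ (2 - 1)) • ContinuousLinearMap.proj (R := ℝ) (φ := fun _ : Fin 3 => ℝ) 0 +
    ((2 : ℕ) • p 1 ^ (2 - 1)) • ContinuousLinearMap.proj (R := ℝ) (φ := fun _ : Fin 3 => ℝ) 1 +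
    ((2 : ℕ) • p 2 ^ (2 - 1)) • ContinuousLinearMap.proj (R := ℝ) (φ := fun _ : Fin 3 => ℝ) 2

theorem sqn'_apply (p v : Fin 3 → ℝ) :
    sqn' p v = 2 * p 0 * v 0 + 2 * p 1 * v 1 + 2 * p 2 * v 2 := by
  simp [sqn']

theorem hasFDerivAt_sqn (p : Fin 3 → ℝ) : HasFDerivAt sqn (sqn' p) p := by
  unfold sqn sqn'
  exact (((hasFDerivAt_apply (𝕜 := ℝ) (0 : Fin 3) p).pow 2).add
    ((hasFDerivAt_apply (𝕜 := ℝ) (1 : Fin 3) p).pow 2)).add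
    ((hasFDerivAt_apply (𝕜 := ℝ) (2 : Fin 3) p).pow 2)

/-- The derivative of `inv3` at `p` (for `sqn p ≠ 0`). -/
def inv3' (p : Fin 3 → ℝ) : (Fin 3 → ℝ) →L[ℝ] (Fin 3 → ℝ) :=
  (sqn p)⁻¹ • ContinuousLinearMap.id ℝ (Fin 3 → ℝ) +
    ((ContinuousLinearMap.toSpanSingleton ℝ (-(sqn p ^ 2)⁻¹)).comp (sqn' p)).smulRight p

theorem hasFDerivAt_inv3 {p : Fin 3 → ℝ} (h : sqn p ≠ 0) : HasFDerivAt inv3 (inv3' p) p := by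
  have h1 : HasFDerivAt (fun q => (sqn q)⁻¹)
      ((ContinuousLinearMap.toSpanSingleton ℝ (-(sqn p ^ 2)⁻¹)).comp (sqn' p)) p :=
    (hasFDerivAt_inv h).comp p (hasFDerivAt_sqn p)
  have h2 := h1.smul (hasFDerivAt_id p)
  exact h2

theorem inv3'_apply (p v : Fin 3 → ℝ) (i : Fin 3) :
    inv3' p v i = (sqn p)⁻¹ * v i + (-(sqn p ^ 2)⁻¹ * (2 * p 0 * v 0 + 2 * p 1 * v 1 + 2 * p 2 * v 2)) * p i := by
  have e : inv3' p v = (sqn p)⁻¹ • v + ((sqn' p v) • (-(sqn p ^ 2)⁻¹)) • p := rfl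
  rw [e]
  simp only [Pi.add_apply, Pi.smul_apply, smul_eq_mul, sqn'_apply]
  ring

/-- The matrix of `inv3' p`. -/
def invMat (p : Fin 3 → ℝ) : Matrix (Fin 3) (Fin 3) ℝ :=
  fun i j => (if i = j then (sqn p)⁻¹ else 0) - 2 * (sqn p ^ 2)⁻¹ * p i * p j

theorem inv3'_eq_toLin (p : Fin 3 → ℝ) :
    (inv3' p : (Fin 3 → ℝ) →ₗ[ℝ] (Fin 3 → ℝ)) = Matrix.toLin' (invMat p) := by
  apply LinearMap.ext
  intro v
  funext i
  rw [ContinuousLinearMap.coe_coe, inv3'_apply, Matrix.toLin'_apply]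
  simp [Matrix.mulVec, dotProduct, Fin.sum_univ_three, invMat]
  fin_cases i <;> simp <;> ring

theorem det_inv3' {p : Fin 3 → ℝ} (h : sqn p ≠ 0) : (inv3' p).det = -((sqn p)⁻¹ ^ 3) := by
  rw [ContinuousLinearMap.det, inv3'_eq_toLin, LinearMap.det_toLin', Matrix.det_fin_three]
  simp [invMat]
  have hs : p 0 ^ 2 + p 1 ^ 2 + p 2 ^ 2 = sqn p := rfl
  field_simp
  rw [← hs]
  ring

theorem abs_det_inv3' {p : Fin 3 → ℝ} (h : 0 < sqn p) : |(inv3' p).det| = (sqn p)⁻¹ ^ 3 := by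
  rw [det_inv3' h.ne', abs_neg, abs_of_pos (by positivity)]

/-! ### The ideal tetrahedron under inversion -/

theorem conj_inv_re (x : ℂ) : (conj x⁻¹).re = x.re / Complex.normSq x := by
  simp [Complex.inv_re]

theorem conj_inv_im (x : ℂ) : (conj x⁻¹).im = x.im / Complex.normSq x := by
  simp [Complex.inv_im]

theorem normSq_conj_inv (x : ℂ) : Complex.normSq (conj x⁻¹) = (Complex.normSq x)⁻¹ := by
  simp

theorem conj_inv_im_pos {x : ℂ} (him : 0 < x.im) : 0 < (conj x⁻¹).im := by
  rw [conj_inv_im]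
  exact div_pos him (Complex.normSq_pos.mpr (by rintro rfl; simp at him))

theorem conj_inv_conj_inv (x : ℂ) : conj (conj x⁻¹)⁻¹ = x := by simp

/-- Inversion maps `T(x)` into `T(1/x̄) = T(conj x⁻¹)`: the five defining inequalities are
exchanged (edge `0x` ↔ edge `0x'`, edge `1x` ↔ hemisphere, hemisphere ↔ edge `1x'`). -/
theorem inv3_mem {x : ℂ} (him : 0 < x.im) {p : Fin 3 → ℝ} (hp : p ∈ idealTetrahedron x) :
    inv3 p ∈ idealTetrahedron (conj x⁻¹) := by
  obtain ⟨h1, h2, h3, h4, h5⟩ := hp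
  have hs : 0 < sqn p := sqn_pos h4
  have hN : 0 < Complex.normSq x := Complex.normSq_pos.mpr (by rintro rfl; simp at him)
  have hNs : 0 < Complex.normSq x * sqn p := mul_pos hN hs
  rw [mem_idealTetrahedron_iff]
  simp only [inv3_apply]
  rw [conj_inv_re, conj_inv_im, normSq_conj_inv]
  set N := Complex.normSq x with hNdef
  set s := sqn p with hsdef
  have hs0 : s ≠ 0 := hs.ne'
  have hN0 : N ≠ 0 := hN.ne'
  have hsq : p 0 ^ 2 + p 1 ^ 2 + p 2 ^ 2 = s := rfl
  refine ⟨div_pos h1 hs, ?_, ?_, div_pos h4 hs, ?_⟩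
  · -- edge `0x`
    have e : x.im / N * (p 0 / s) - x.re / N * (p 1 / s) = (x.im * p 0 - x.re * p 1) / (N * s) := by
      field_simp
    have : 0 < x.im / N * (p 0 / s) - x.re / N * (p 1 / s) := by
      rw [e]; exact div_pos (by linarith) hNs
    linarith
  · -- edge `1x'` from the hemisphere of `T(x)`
    have e : (x.re / N - 1) * (p 1 / s) - x.im / N * (p 0 / s - 1) =
        (x.im * (s - p 0) + (x.re - N) * p 1) / (N * s) := by
      field_simp
      ring
    have h5' : 0 < x.im * (s - p 0) + (x.re - N) * p 1 := by rw [← hsq]; linarith [h5]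
    have : 0 < (x.re / N - 1) * (p 1 / s) - x.im / N * (p 0 / s - 1) := by
      rw [e]; exact div_pos h5' hNs
    linarith
  · -- hemisphere of `T(x')` from the edge `1x`
    have e : x.im / N * ((p 0 / s) ^ 2 + (p 1 / s) ^ 2 + (p 2 / s) ^ 2 - p 0 / s) +
        (x.re / N - N⁻¹) * (p 1 / s) = (x.im * (1 - p 0) + (x.re - 1) * p 1) / (N * s) := by
      have e2 : (p 0 / s) ^ 2 + (p 1 / s) ^ 2 + (p 2 / s) ^ 2 = 1 / s := by
        field_simp
        rw [← hsq]
      rw [e2]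
      field_simp
    rw [e]
    exact div_pos (by linarith) hNs

/-- The image of `T(x)` under inversion is `T(1/x̄)`. -/
theorem image_inv3 {x : ℂ} (him : 0 < x.im) :
    inv3 '' idealTetrahedron x = idealTetrahedron (conj x⁻¹) := by
  apply Subset.antisymm
  · rintro _ ⟨p, hp, rfl⟩
    exact inv3_mem him hp
  · intro q hq
    refine ⟨inv3 q, ?_, inv3_inv3 (sqn_pos (pos_of_mem_idealTetrahedron hq)).ne'⟩
    have h := inv3_mem (conj_inv_im_pos him) hq
    rwa [conj_inv_conj_inv] at h

/-- Inversion is a `ℚ`-semialgebraic map on every `ℚ`-semialgebraic subset of `{p 2 > 0}`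
(coordinates `Xᵢ / (X₀² + X₁² + X₂²)`). -/
theorem isSemialgebraicMapOn_inv3 {σ : Set (Fin 3 → ℝ)} (hσ : IsSemialgebraic ℚ σ)
    (h : σ ⊆ {p | 0 < p 2}) : IsSemialgebraicMapOn ℚ σ inv3 := by
  refine IsSemialgebraicMapOn.of_forall hσ fun j => ?_
  have hq : ∀ p ∈ σ, aeval p (X 0 ^ 2 + X 1 ^ 2 + X 2 ^ 2 : MvPolynomial (Fin 3) ℚ) ≠ 0 := by
    intro p hp
    have := (sqn_pos (h hp)).ne'
    simpa [sqn] using this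
  refine (isSemialgebraicFunOn_aeval_div_aeval hσ (X j) (X 0 ^ 2 + X 1 ^ 2 + X 2 ^ 2) hq).congr ?_
  intro p _
  simp [inv3_apply, sqn]

/-- **The inversion move.** For algebraic `x` in the upper half plane, the standard representations
on `T(x)` and on `T(1/x̄)` differ by ONE change-of-variables generator (inversion in the unit
sphere, `|det| = |p|⁻⁶`, `t⁻³ = (t/|p|²)⁻³ · |p|⁻⁶`). -/
theorem inversion_mem_changeOfVariablesRel {x : ℂ} (hx : IsAlgebraic ℚ x) (him : 0 < x.im)
    (hx' : IsAlgebraic ℚ (conj x⁻¹)) (him' : 0 < (conj x⁻¹).im) :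
    KZ.of (idealTetrahedronRep x hx him) - KZ.of (idealTetrahedronRep (conj x⁻¹) hx' him') ∈
      changeOfVariablesRel := by
  refine ⟨3, idealTetrahedronRep x hx him, idealTetrahedronRep (conj x⁻¹) hx' him', inv3, inv3',
    ?_, ?_, ?_, ?_, ?_, rfl⟩
  · exact isSemialgebraicMapOn_inv3 (idealTetrahedronRep x hx him).isSemialgebraic_domain
      fun p hp => pos_of_mem_idealTetrahedron hp
  · intro p hp
    exact (hasFDerivAt_inv3 (sqn_pos (pos_of_mem_idealTetrahedron hp)).ne').hasFDerivWithinAt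
  · exact injOn_inv3 fun p hp => (sqn_pos (pos_of_mem_idealTetrahedron hp)).ne'
  · exact (image_inv3 him).symm
  · intro p hp
    have hs : 0 < sqn p := sqn_pos (pos_of_mem_idealTetrahedron hp)
    have ht : 0 < p 2 := pos_of_mem_idealTetrahedron hp
    simp only [integrand_idealTetrahedronRep, inv3_apply, abs_det_inv3' hs]
    field_simp

theorem isAlgebraic_conj_inv {x : ℂ} (hx : IsAlgebraic ℚ x) : IsAlgebraic ℚ (conj x⁻¹) := by
  simpa using hx.inv.algHom (starRingEnd ℂ).toRatAlgHom

/-- The inversion relation `[T(x)] − [T(1/x̄)] ∈ KZ.relations`. -/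
theorem inversion_mem_relations {x : ℂ} (hx : IsAlgebraic ℚ x) (him : 0 < x.im) :
    KZ.of (idealTetrahedronRep x hx him) -
      KZ.of (idealTetrahedronRep (conj x⁻¹) (isAlgebraic_conj_inv hx) (conj_inv_im_pos him)) ∈
      relations :=
  changeOfVariablesRel_subset_relations (inversion_mem_changeOfVariablesRel hx him _ _)


/-- **The instance `y = 1` holds** for every standard family and every algebraic `x`:
`B x + B x⁻¹ ∈ KZ.relations` (inversion move, conjugated to the upper half plane). [folklore] -/
theorem fiveTerm_one_right_mem_relations {ρ : ℂ → IntegralRep 3} (hρ : IsStandardOn ρ) {x : ℂ}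
    (hx : IsAlgebraic ℚ x) : fiveTerm (signedClass ρ) x 1 ∈ relations := by
  -- the upper-half-plane case, for any `w`
  have upper : ∀ {w : ℂ}, IsAlgebraic ℚ w → 0 < w.im →
      KZ.of (ρ w) - KZ.of (ρ (conj w⁻¹)) ∈ relations := by
    intro w hw hwi
    have hw' : IsAlgebraic ℚ (conj w⁻¹) := isAlgebraic_conj_inv hw
    have hwi' : 0 < (conj w⁻¹).im := conj_inv_im_pos hwi
    have a := of_sub_of_mem_relations_of_isStandardOn hρ isStandardOn_ρ₀ hw hwi
    have b := inversion_mem_relations hw hwi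
    have c := of_sub_of_mem_relations_of_isStandardOn isStandardOn_ρ₀ hρ hw' hwi'
    rw [show ρ₀ w = idealTetrahedronRep w hw hwi from stdRep_of_pos _ hw hwi] at a
    rw [show ρ₀ (conj w⁻¹) = idealTetrahedronRep (conj w⁻¹) hw' hwi' from
      stdRep_of_pos _ hw' hwi'] at c
    have e : KZ.of (ρ w) - KZ.of (ρ (conj w⁻¹)) = (KZ.of (ρ w) - KZ.of (idealTetrahedronRep w hw hwi))
        + (KZ.of (idealTetrahedronRep w hw hwi)
            - KZ.of (idealTetrahedronRep (conj w⁻¹) hw' hwi'))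
        + (KZ.of (idealTetrahedronRep (conj w⁻¹) hw' hwi') - KZ.of (ρ (conj w⁻¹))) := by abel
    rw [e]
    exact add_mem (add_mem a b) c
  rcases lt_trichotomy x.im 0 with h | h | h
  · -- lower half plane: conjugate
    have hxi : (x⁻¹).im > 0 := by
      rw [Complex.inv_im]
      exact div_pos (neg_pos.mpr h) (Complex.normSq_pos.mpr (by rintro rfl; simp at h))
    rw [fiveTerm_one_right, signedClass_of_im_neg ρ h, signedClass_of_im_pos ρ hxi]
    have hc : IsAlgebraic ℚ (conj x) := by simpa using hx.algHom (starRingEnd ℂ).toRatAlgHom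
    have u := upper hc (by simpa using h)
    rw [show conj (conj x)⁻¹ = x⁻¹ by simp] at u
    have e : -KZ.of (ρ (conj x)) + KZ.of (ρ x⁻¹) = -(KZ.of (ρ (conj x)) - KZ.of (ρ x⁻¹)) := by abel
    rw [e]
    exact neg_mem u
  · -- real line
    have hxi : (x⁻¹).im = 0 := by simp [Complex.inv_im, h]
    rw [fiveTerm_one_right, signedClass_of_im_zero ρ h, signedClass_of_im_zero ρ hxi, add_zero]
    exact zero_mem _
  · rw [fiveTerm_one_right_of_im_pos ρ h]
    exact upper hx h

/-- **Final reduction.** The crux is equivalent to its instance for the single standard family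
`ρ₀` with ONLY the two essential side conditions `x ≠ 0`, `y ≠ 0` (which ARE load-bearing,
§2). [folklore] -/
theorem fiveTermTransfer_iff_ρ₀' :
    FiveTermTransfer ↔ ∀ x y : ℂ, IsAlgebraic ℚ x → IsAlgebraic ℚ y → x ≠ 0 → y ≠ 0 →
      fiveTerm (signedClass ρ₀) x y ∈ relations := by
  rw [fiveTermTransfer_iff_ρ₀]
  constructor
  · intro h x y hx hy hx0 hy0
    rcases eq_or_ne y 1 with rfl | hy1
    · exact fiveTerm_one_right_mem_relations isStandardOn_ρ₀ hx
    · exact h x y hx hy hx0 hy0 hy1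
  · intro h x y hx hy hx0 hy0 _
    exact h x y hx hy hx0 hy0

/-! ## §6 Dictionary: the signs of the five arguments are polynomial signs (Radon minors)

For the provers' chamber analysis: `sign Im` of each argument of `B` is the sign of a polynomial in
`(Re x, Im x, Re y, Im y)` — the orientation of `(0, x, y)`, minus the orientation of `(1, x, y)`,
and the concyclicity determinant of `(0, 1, x, y)` — i.e. (up to the fixed positive factors
displayed) the `4 × 4` minors of the lifted configuration `{∞, 0, 1, x, y}` whose signs are the
Radon coefficients (numerically: census rule of item 3 of the header). Also `z₄ = z₃ · z₅`. -/

/-- `z₄ = z₃ · z₅`: `(1 − x⁻¹)/(1 − y⁻¹) = (y/x) · ((1 − x)/(1 − y))`. [folklore] -/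
theorem arg_four_eq_mul {x y : ℂ} (hx : x ≠ 0) (hy : y ≠ 0) (hy1 : y ≠ 1) :
    (1 - x⁻¹) / (1 - y⁻¹) = (y / x) * ((1 - x) / (1 - y)) := by
  have h1 : (1 : ℂ) - y ≠ 0 := sub_ne_zero.mpr (Ne.symm hy1)
  have h2 : (1 : ℂ) - y⁻¹ ≠ 0 := by
    rw [sub_ne_zero, ne_comm, ne_eq, inv_eq_one]; exact hy1
  field_simp
  ring

/-- `Im (y/x) · |x|² = Re x · Im y − Im x · Re y` (twice the signed area of `(0, x, y)`). [folklore] -/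
theorem im_arg_three (x y : ℂ) : (y / x).im * Complex.normSq x = x.re * y.im - x.im * y.re := by
  rcases eq_or_ne x 0 with rfl | hx
  · simp
  have hN : Complex.normSq x ≠ 0 := (Complex.normSq_pos.mpr hx).ne'
  rw [Complex.div_im]
  field_simp

/-- `Im ((1−x)/(1−y)) · |1−y|² = −((Re x − 1) · Im y − Im x · (Re y − 1))` (minus twice the signed
area of `(1, x, y)`). [folklore] -/
theorem im_arg_five (x y : ℂ) : ((1 - x) / (1 - y)).im * Complex.normSq (1 - y) =
    -((x.re - 1) * y.im - x.im * (y.re - 1)) := by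
  rcases eq_or_ne y 1 with rfl | hy
  · simp
  have hN : Complex.normSq (1 - y) ≠ 0 :=
    (Complex.normSq_pos.mpr (sub_ne_zero.mpr (Ne.symm hy))).ne'
  rw [Complex.div_im]
  field_simp
  simp
  ring

/-- `Im z₄ · |x|² |1−y|² = Re x · Im y − Im x · Re y − |x|² · Im y + Im x · |y|²`, the
concyclicity determinant `det (|p|², Re p, Im p)_{p = 1, x, y}` of `(0, 1, x, y)` (vanishes iff the
four points are concyclic or collinear). Needs `x ≠ 0`, `y ∉ {0, 1}` (division junk otherwise).
[folklore] -/
theorem im_arg_four {x y : ℂ} (hx : x ≠ 0) (hy : y ≠ 0) (hy1 : y ≠ 1) :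
    ((1 - x⁻¹) / (1 - y⁻¹)).im * (Complex.normSq x * Complex.normSq (1 - y)) =
      x.re * y.im - x.im * y.re - Complex.normSq x * y.im + x.im * Complex.normSq y := by
  have e : (1 - x⁻¹) / (1 - y⁻¹) = (y * (1 - x)) / (x * (1 - y)) := by
    rw [arg_four_eq_mul hx hy hy1, div_mul_div_comm]
  rw [e, Complex.div_im, Complex.normSq_mul]
  have hN : Complex.normSq x ≠ 0 := (Complex.normSq_pos.mpr hx).ne'
  have hM : Complex.normSq (1 - y) ≠ 0 :=
    (Complex.normSq_pos.mpr (sub_ne_zero.mpr (Ne.symm hy1))).ne'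
  field_simp
  simp [Complex.normSq_apply]
  ring

/-!
## Appendix: sign census (numerics, this seat; script `census.py` in the seat folder)

`s = (sign Im zᵢ)ᵢ` for `z = (x, y, y/x, (1−x⁻¹)/(1−y⁻¹), (1−x)/(1−y))`, `ε = (+,−,+,−,+) · s` = the
coefficients of the five standard tetrahedra in the element (after `B`), term `i` omitting the point
`(y, x, 1, ∞, 0)ᵢ` of `{∞, 0, 1, x, y}`. Observed over 2·10⁵ generic pairs and 10⁵ wall pairs
(y real, x real, y ∈ ℝx, y ∈ 1 + ℝ(x−1), y on the circle through 0, 1, x): exactly the patterns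
below. Zero-free patterns: `Σε = ±1` and the two minority-sign terms omit the two APEXES of the
bipyramid (checked against the Radon partition in every sample; indicator identity
`Σ εᵢ 𝟙_{Δᵢ} = 0` checked at 3.6·10⁵ points, 0 violations). One-zero patterns: 2–2 split.
-/
-- zero-free patterns (20):
--   s=−−−−−  ε=−+−+−  Σε=-1  apexes {x,∞}
--   s=−−−−+  ε=−+−++  Σε=+1  apexes {y,1}
--   s=−−−++  ε=−+−−+  Σε=-1  apexes {x,0}
--   s=−−+−−  ε=−+++−  Σε=+1  apexes {y,0}
--   s=−−++−  ε=−++−−  Σε=-1  apexes {x,1}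
--   s=−−+++  ε=−++−+  Σε=+1  apexes {y,∞}
--   s=−+−−+  ε=−−−++  Σε=-1  apexes {∞,0}
--   s=−++−−  ε=−−++−  Σε=-1  apexes {1,∞}
--   s=−++−+  ε=−−+++  Σε=+1  apexes {y,x}
--   s=−++++  ε=−−+−+  Σε=-1  apexes {1,0}
--   s=+−−−−  ε=++−+−  Σε=+1  apexes {1,0}
--   s=+−−+−  ε=++−−−  Σε=-1  apexes {y,x}
--   s=+−−++  ε=++−−+  Σε=+1  apexes {1,∞}
--   s=+−++−  ε=+++−−  Σε=+1  apexes {∞,0}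
--   s=++−−−  ε=+−−+−  Σε=-1  apexes {y,∞}
--   s=++−−+  ε=+−−++  Σε=+1  apexes {x,1}
--   s=++−++  ε=+−−−+  Σε=-1  apexes {y,0}
--   s=+++−−  ε=+−++−  Σε=+1  apexes {x,0}
--   s=++++−  ε=+−+−−  Σε=-1  apexes {y,1}
--   s=+++++  ε=+−+−+  Σε=+1  apexes {x,∞}
-- one-zero patterns (30):
--   s=−−−−0  ε=−+−+0  Σε=+0  (4-concyclic: term omitting 0 drops, 2–2 split)
--   s=−−−0+  ε=−+−0+  Σε=+0  (4-concyclic: term omitting ∞ drops, 2–2 split)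
--   s=−−0−−  ε=−+0+−  Σε=+0  (4-concyclic: term omitting 1 drops, 2–2 split)
--   s=−−0++  ε=−+0−+  Σε=+0  (4-concyclic: term omitting 1 drops, 2–2 split)
--   s=−−+0−  ε=−++0−  Σε=+0  (4-concyclic: term omitting ∞ drops, 2–2 split)
--   s=−−++0  ε=−++−0  Σε=+0  (4-concyclic: term omitting 0 drops, 2–2 split)
--   s=−0−−+  ε=−0−++  Σε=+0  (4-concyclic: term omitting x drops, 2–2 split)
--   s=−0+−−  ε=−0++−  Σε=+0  (4-concyclic: term omitting x drops, 2–2 split)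
--   s=−0+++  ε=−0+−+  Σε=+0  (4-concyclic: term omitting x drops, 2–2 split)
--   s=−+0−+  ε=−−0++  Σε=+0  (4-concyclic: term omitting 1 drops, 2–2 split)
--   s=−++−0  ε=−−++0  Σε=+0  (4-concyclic: term omitting 0 drops, 2–2 split)
--   s=−++0+  ε=−−+0+  Σε=+0  (4-concyclic: term omitting ∞ drops, 2–2 split)
--   s=0−−−−  ε=0+−+−  Σε=+0  (4-concyclic: term omitting y drops, 2–2 split)
--   s=0−−++  ε=0+−−+  Σε=+0  (4-concyclic: term omitting y drops, 2–2 split)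
--   s=0−++−  ε=0++−−  Σε=+0  (4-concyclic: term omitting y drops, 2–2 split)
--   s=0+−−+  ε=0−−++  Σε=+0  (4-concyclic: term omitting y drops, 2–2 split)
--   s=0++−−  ε=0−++−  Σε=+0  (4-concyclic: term omitting y drops, 2–2 split)
--   s=0++++  ε=0−+−+  Σε=+0  (4-concyclic: term omitting y drops, 2–2 split)
--   s=+−−0−  ε=++−0−  Σε=+0  (4-concyclic: term omitting ∞ drops, 2–2 split)
--   s=+−−+0  ε=++−−0  Σε=+0  (4-concyclic: term omitting 0 drops, 2–2 split)
--   s=+−0+−  ε=++0−−  Σε=+0  (4-concyclic: term omitting 1 drops, 2–2 split)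
--   s=+0−−−  ε=+0−+−  Σε=+0  (4-concyclic: term omitting x drops, 2–2 split)
--   s=+0−++  ε=+0−−+  Σε=+0  (4-concyclic: term omitting x drops, 2–2 split)
--   s=+0++−  ε=+0+−−  Σε=+0  (4-concyclic: term omitting x drops, 2–2 split)
--   s=++−−0  ε=+−−+0  Σε=+0  (4-concyclic: term omitting 0 drops, 2–2 split)
--   s=++−0+  ε=+−−0+  Σε=+0  (4-concyclic: term omitting ∞ drops, 2–2 split)
--   s=++0−−  ε=+−0+−  Σε=+0  (4-concyclic: term omitting 1 drops, 2–2 split)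
--   s=++0++  ε=+−0−+  Σε=+0  (4-concyclic: term omitting 1 drops, 2–2 split)
--   s=+++0−  ε=+−+0−  Σε=+0  (4-concyclic: term omitting ∞ drops, 2–2 split)
--   s=++++0  ε=+−+−0  Σε=+0  (4-concyclic: term omitting 0 drops, 2–2 split)
-- degenerate patterns (1):
--   s=00000  (≥2 zeros: 5)

end Summit.KontsevichZagierPeriods.KontsevichZagierPeriods.Cruxes.FiveTermTransfer.Disproof
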